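import Literature.Computability.FineGrained.LightSatSplitting
import Literature.Computability.Complexity.StackArith
import Literature.Computability.Complexity.StackMachinesTM2
import Literature.Computability.Complexity.GenPrograms
import HarnessLib

/-!
# Exhaustive search of light assignments, II: the search program and the specifications of its passes

Family `fine-grained` (trunk T-CPLX-FINE), groundwork for `Literature.Computability.FineGrained.lightKSAT_exhaustiveSearch`
(Impagliazzo–Paturi 2001, p. 370: exhaustive search of the assignments with at most `δ n` ones,
`δ = 1/N`), continuing `LightSatSplitting.lean` (the budgeted splitting search `searchB`,
`restrict`, `pivot`; the token code `Tok`, `formulaToks`, `bits`, `hdrToks`). The search is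
programmed as a structured stack program (`Literature.Computability.Complexity.Com`, `StackPrograms.lean`) over 28
binary registers (`R`), to be run on `Turing.FinTM2` through `StackMachinesTM2.lean`, and
every pass is proved to follow a functional specification:

* register file bookkeeping: `RF` (the registers by name), `mk`, and the `simp` normal form
  `Function.update (mk ρ) r v = mk {ρ with r := v}`;
* the token reader `tokCase`/`tokLoop` (dispatch on the prefix code) with its one-token rule
  `runs_tokCase`, `emit` (write a token, by `GenProg.pushes` of `GenPrograms.lean`), and the
  generic loop theorems
  `runs_tokLoop_of_spec` (a token loop whose handlers act as `S t` on named files ends in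
  `specFold S`), `specFold_eq_foldl`, `costFold_le` (cost from a potential);
* the prelude computing the budget `⌊min(n, N · cap) / N⌋` in unary from the header bits
  (`hdrTok`, `dblBody` — saturating doubling —, `grpBody` — grouping by `N`), the passes of one
  iteration of the worklist loop — `extractTok` (split the worklist at the first `endf`,
  budget units to `bu`), `scanTok` (copy the formula, detect an empty clause, collect the
  pivot), `restrictTok v cp` (emit the code of `restrict F x v`, comparing every literal index
  with the pivot register bit by bit) — and the whole program `searchProg` (`body`, `mainLoop`,
  `splitStep` with the budget rule: the child `x := true` is pushed with budget `b - 1` only if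
  `b ≥ 1`, the child `x := false` keeps `b`);
* for each pass, the functional specification of its handler, the simulation theorem for one
  token, the closed form on the code of a formula, and polynomial cost bounds.

The analysis of the worklist loop (`mainLoop`: invariant and simulation of `searchB`), of the
whole program `searchProg` and of the compiled machine, with the running-time bound and
`lightKSAT_exhaustiveSearch_holds`, is in `LightSatMachine.lean`.

## References

* R. Impagliazzo, R. Paturi, *On the complexity of k-SAT*, JCSS 62 (2001), p. 370 and proof
  of Theorem 3, step 1 (p. 374).
* M. Davis, G. Logemann, D. Loveland, *A machine program for theorem-proving*, Comm. ACM 5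
  (1962), 394–397 (the splitting rule).
* T. Nipkow, G. Klein, *Concrete Semantics with Isabelle/HOL*, Springer 2014, Ch. 7 (big-step
  reasoning; rule induction on loops).
-/

namespace Literature.Computability.FineGrained.LightSearch

open Complexity Complexity.Com _root_.Computability

/-! ### Registers -/

/-- The 28 registers of the search program: worklist `w` (the input register) and its stash
`w2`; the current formula `f` (and reversed `fr`), its copies `f2`, `f3` (reversed `f2r`,
`f3r`); the pivot `x` (reversed `xr`, working copy `xc`); scratch `t`, `u`; literal and clause
buffers `lb`, `cb`; output buffer `o`; polarity `pb`; flags `mis` (index mismatch), `sat`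
(clause satisfied), `ls` (literal seen), `he` (empty clause seen), `md` (mode); the budget of
the current entry `bu`; the prelude's header bits `hd`, unary accumulator `uu`, capacity `cc`
and scratch `tt`; `out` (the output register). [folklore] -/
inductive R
  | w | w2 | fr | f | f2r | f2 | f3r | f3 | xr | x | xc | t | u | lb | cb | o | pb | mis | sat | ls | he | md | bu | hd | uu | cc | tt | out
  deriving DecidableEq, Fintype

/-- The register file by name. [folklore] -/
structure RF where
  (w w2 fr f f2r f2 f3r f3 xr x xc t u lb cb o pb mis sat ls he md bu hd uu cc tt out : List Bool)

/-- The all-empty register file. [folklore] -/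
def RF.zero : RF := ⟨[], [], [], [], [], [], [], [], [], [], [], [], [], [], [], [], [], [], [], [], [], [], [], [], [], [], [], []⟩


/-- register `w` of the empty file. [folklore] -/
@[simp] theorem RF.zero_w : RF.zero.w = [] := rfl

/-- register `w2` of the empty file. [folklore] -/
@[simp] theorem RF.zero_w2 : RF.zero.w2 = [] := rfl

/-- register `fr` of the empty file. [folklore] -/
@[simp] theorem RF.zero_fr : RF.zero.fr = [] := rfl

/-- register `f` of the empty file. [folklore] -/
@[simp] theorem RF.zero_f : RF.zero.f = [] := rfl

/-- register `f2r` of the empty file. [folklore] -/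
@[simp] theorem RF.zero_f2r : RF.zero.f2r = [] := rfl

/-- register `f2` of the empty file. [folklore] -/
@[simp] theorem RF.zero_f2 : RF.zero.f2 = [] := rfl

/-- register `f3r` of the empty file. [folklore] -/
@[simp] theorem RF.zero_f3r : RF.zero.f3r = [] := rfl

/-- register `f3` of the empty file. [folklore] -/
@[simp] theorem RF.zero_f3 : RF.zero.f3 = [] := rfl

/-- register `xr` of the empty file. [folklore] -/
@[simp] theorem RF.zero_xr : RF.zero.xr = [] := rfl

/-- register `x` of the empty file. [folklore] -/
@[simp] theorem RF.zero_x : RF.zero.x = [] := rfl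

/-- register `xc` of the empty file. [folklore] -/
@[simp] theorem RF.zero_xc : RF.zero.xc = [] := rfl

/-- register `t` of the empty file. [folklore] -/
@[simp] theorem RF.zero_t : RF.zero.t = [] := rfl

/-- register `u` of the empty file. [folklore] -/
@[simp] theorem RF.zero_u : RF.zero.u = [] := rfl

/-- register `lb` of the empty file. [folklore] -/
@[simp] theorem RF.zero_lb : RF.zero.lb = [] := rfl

/-- register `cb` of the empty file. [folklore] -/
@[simp] theorem RF.zero_cb : RF.zero.cb = [] := rfl

/-- register `o` of the empty file. [folklore] -/
@[simp] theorem RF.zero_o : RF.zero.o = [] := rfl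

/-- register `pb` of the empty file. [folklore] -/
@[simp] theorem RF.zero_pb : RF.zero.pb = [] := rfl

/-- register `mis` of the empty file. [folklore] -/
@[simp] theorem RF.zero_mis : RF.zero.mis = [] := rfl

/-- register `sat` of the empty file. [folklore] -/
@[simp] theorem RF.zero_sat : RF.zero.sat = [] := rfl

/-- register `ls` of the empty file. [folklore] -/
@[simp] theorem RF.zero_ls : RF.zero.ls = [] := rfl

/-- register `he` of the empty file. [folklore] -/
@[simp] theorem RF.zero_he : RF.zero.he = [] := rfl

/-- register `md` of the empty file. [folklore] -/
@[simp] theorem RF.zero_md : RF.zero.md = [] := rfl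

/-- register `bu` of the empty file. [folklore] -/
@[simp] theorem RF.zero_bu : RF.zero.bu = [] := rfl

/-- register `hd` of the empty file. [folklore] -/
@[simp] theorem RF.zero_hd : RF.zero.hd = [] := rfl

/-- register `uu` of the empty file. [folklore] -/
@[simp] theorem RF.zero_uu : RF.zero.uu = [] := rfl

/-- register `cc` of the empty file. [folklore] -/
@[simp] theorem RF.zero_cc : RF.zero.cc = [] := rfl

/-- register `tt` of the empty file. [folklore] -/
@[simp] theorem RF.zero_tt : RF.zero.tt = [] := rfl

/-- register `out` of the empty file. [folklore] -/
@[simp] theorem RF.zero_out : RF.zero.out = [] := rfl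


/-- A named register file as a function. [folklore] -/
def mk (ρ : RF) : Regs R
  | .w => ρ.w
  | .w2 => ρ.w2
  | .fr => ρ.fr
  | .f => ρ.f
  | .f2r => ρ.f2r
  | .f2 => ρ.f2
  | .f3r => ρ.f3r
  | .f3 => ρ.f3
  | .xr => ρ.xr
  | .x => ρ.x
  | .xc => ρ.xc
  | .t => ρ.t
  | .u => ρ.u
  | .lb => ρ.lb
  | .cb => ρ.cb
  | .o => ρ.o
  | .pb => ρ.pb
  | .mis => ρ.mis
  | .sat => ρ.sat
  | .ls => ρ.ls
  | .he => ρ.he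
  | .md => ρ.md
  | .bu => ρ.bu
  | .hd => ρ.hd
  | .uu => ρ.uu
  | .cc => ρ.cc
  | .tt => ρ.tt
  | .out => ρ.out

/-- reading register `w`. [folklore] -/
@[simp] theorem mk_w (ρ : RF) : mk ρ .w = ρ.w := rfl

/-- reading register `w2`. [folklore] -/
@[simp] theorem mk_w2 (ρ : RF) : mk ρ .w2 = ρ.w2 := rfl

/-- reading register `fr`. [folklore] -/
@[simp] theorem mk_fr (ρ : RF) : mk ρ .fr = ρ.fr := rfl

/-- reading register `f`. [folklore] -/
@[simp] theorem mk_f (ρ : RF) : mk ρ .f = ρ.f := rfl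

/-- reading register `f2r`. [folklore] -/
@[simp] theorem mk_f2r (ρ : RF) : mk ρ .f2r = ρ.f2r := rfl

/-- reading register `f2`. [folklore] -/
@[simp] theorem mk_f2 (ρ : RF) : mk ρ .f2 = ρ.f2 := rfl

/-- reading register `f3r`. [folklore] -/
@[simp] theorem mk_f3r (ρ : RF) : mk ρ .f3r = ρ.f3r := rfl

/-- reading register `f3`. [folklore] -/
@[simp] theorem mk_f3 (ρ : RF) : mk ρ .f3 = ρ.f3 := rfl

/-- reading register `xr`. [folklore] -/
@[simp] theorem mk_xr (ρ : RF) : mk ρ .xr = ρ.xr := rfl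

/-- reading register `x`. [folklore] -/
@[simp] theorem mk_x (ρ : RF) : mk ρ .x = ρ.x := rfl

/-- reading register `xc`. [folklore] -/
@[simp] theorem mk_xc (ρ : RF) : mk ρ .xc = ρ.xc := rfl

/-- reading register `t`. [folklore] -/
@[simp] theorem mk_t (ρ : RF) : mk ρ .t = ρ.t := rfl

/-- reading register `u`. [folklore] -/
@[simp] theorem mk_u (ρ : RF) : mk ρ .u = ρ.u := rfl

/-- reading register `lb`. [folklore] -/
@[simp] theorem mk_lb (ρ : RF) : mk ρ .lb = ρ.lb := rfl

/-- reading register `cb`. [folklore] -/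
@[simp] theorem mk_cb (ρ : RF) : mk ρ .cb = ρ.cb := rfl

/-- reading register `o`. [folklore] -/
@[simp] theorem mk_o (ρ : RF) : mk ρ .o = ρ.o := rfl

/-- reading register `pb`. [folklore] -/
@[simp] theorem mk_pb (ρ : RF) : mk ρ .pb = ρ.pb := rfl

/-- reading register `mis`. [folklore] -/
@[simp] theorem mk_mis (ρ : RF) : mk ρ .mis = ρ.mis := rfl

/-- reading register `sat`. [folklore] -/
@[simp] theorem mk_sat (ρ : RF) : mk ρ .sat = ρ.sat := rfl

/-- reading register `ls`. [folklore] -/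
@[simp] theorem mk_ls (ρ : RF) : mk ρ .ls = ρ.ls := rfl

/-- reading register `he`. [folklore] -/
@[simp] theorem mk_he (ρ : RF) : mk ρ .he = ρ.he := rfl

/-- reading register `md`. [folklore] -/
@[simp] theorem mk_md (ρ : RF) : mk ρ .md = ρ.md := rfl

/-- reading register `bu`. [folklore] -/
@[simp] theorem mk_bu (ρ : RF) : mk ρ .bu = ρ.bu := rfl

/-- reading register `hd`. [folklore] -/
@[simp] theorem mk_hd (ρ : RF) : mk ρ .hd = ρ.hd := rfl

/-- reading register `uu`. [folklore] -/
@[simp] theorem mk_uu (ρ : RF) : mk ρ .uu = ρ.uu := rfl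

/-- reading register `cc`. [folklore] -/
@[simp] theorem mk_cc (ρ : RF) : mk ρ .cc = ρ.cc := rfl

/-- reading register `tt`. [folklore] -/
@[simp] theorem mk_tt (ρ : RF) : mk ρ .tt = ρ.tt := rfl

/-- reading register `out`. [folklore] -/
@[simp] theorem mk_out (ρ : RF) : mk ρ .out = ρ.out := rfl

/-- updating register `w`. [folklore] -/
@[simp] theorem update_mk_w (ρ : RF) (v : List Bool) :
    Function.update (mk ρ) .w v = mk { ρ with w := v } := by
  funext i; cases i <;> rfl

/-- updating register `w2`. [folklore] -/
@[simp] theorem update_mk_w2 (ρ : RF) (v : List Bool) :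
    Function.update (mk ρ) .w2 v = mk { ρ with w2 := v } := by
  funext i; cases i <;> rfl

/-- updating register `fr`. [folklore] -/
@[simp] theorem update_mk_fr (ρ : RF) (v : List Bool) :
    Function.update (mk ρ) .fr v = mk { ρ with fr := v } := by
  funext i; cases i <;> rfl

/-- updating register `f`. [folklore] -/
@[simp] theorem update_mk_f (ρ : RF) (v : List Bool) :
    Function.update (mk ρ) .f v = mk { ρ with f := v } := by
  funext i; cases i <;> rfl

/-- updating register `f2r`. [folklore] -/
@[simp] theorem update_mk_f2r (ρ : RF) (v : List Bool) :
    Function.update (mk ρ) .f2r v = mk { ρ with f2r := v } := by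
  funext i; cases i <;> rfl

/-- updating register `f2`. [folklore] -/
@[simp] theorem update_mk_f2 (ρ : RF) (v : List Bool) :
    Function.update (mk ρ) .f2 v = mk { ρ with f2 := v } := by
  funext i; cases i <;> rfl

/-- updating register `f3r`. [folklore] -/
@[simp] theorem update_mk_f3r (ρ : RF) (v : List Bool) :
    Function.update (mk ρ) .f3r v = mk { ρ with f3r := v } := by
  funext i; cases i <;> rfl

/-- updating register `f3`. [folklore] -/
@[simp] theorem update_mk_f3 (ρ : RF) (v : List Bool) :
    Function.update (mk ρ) .f3 v = mk { ρ with f3 := v } := by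
  funext i; cases i <;> rfl

/-- updating register `xr`. [folklore] -/
@[simp] theorem update_mk_xr (ρ : RF) (v : List Bool) :
    Function.update (mk ρ) .xr v = mk { ρ with xr := v } := by
  funext i; cases i <;> rfl

/-- updating register `x`. [folklore] -/
@[simp] theorem update_mk_x (ρ : RF) (v : List Bool) :
    Function.update (mk ρ) .x v = mk { ρ with x := v } := by
  funext i; cases i <;> rfl

/-- updating register `xc`. [folklore] -/
@[simp] theorem update_mk_xc (ρ : RF) (v : List Bool) :
    Function.update (mk ρ) .xc v = mk { ρ with xc := v } := by
  funext i; cases i <;> rfl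

/-- updating register `t`. [folklore] -/
@[simp] theorem update_mk_t (ρ : RF) (v : List Bool) :
    Function.update (mk ρ) .t v = mk { ρ with t := v } := by
  funext i; cases i <;> rfl

/-- updating register `u`. [folklore] -/
@[simp] theorem update_mk_u (ρ : RF) (v : List Bool) :
    Function.update (mk ρ) .u v = mk { ρ with u := v } := by
  funext i; cases i <;> rfl

/-- updating register `lb`. [folklore] -/
@[simp] theorem update_mk_lb (ρ : RF) (v : List Bool) :
    Function.update (mk ρ) .lb v = mk { ρ with lb := v } := by
  funext i; cases i <;> rfl

/-- updating register `cb`. [folklore] -/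
@[simp] theorem update_mk_cb (ρ : RF) (v : List Bool) :
    Function.update (mk ρ) .cb v = mk { ρ with cb := v } := by
  funext i; cases i <;> rfl

/-- updating register `o`. [folklore] -/
@[simp] theorem update_mk_o (ρ : RF) (v : List Bool) :
    Function.update (mk ρ) .o v = mk { ρ with o := v } := by
  funext i; cases i <;> rfl

/-- updating register `pb`. [folklore] -/
@[simp] theorem update_mk_pb (ρ : RF) (v : List Bool) :
    Function.update (mk ρ) .pb v = mk { ρ with pb := v } := by
  funext i; cases i <;> rfl

/-- updating register `mis`. [folklore] -/
@[simp] theorem update_mk_mis (ρ : RF) (v : List Bool) :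
    Function.update (mk ρ) .mis v = mk { ρ with mis := v } := by
  funext i; cases i <;> rfl

/-- updating register `sat`. [folklore] -/
@[simp] theorem update_mk_sat (ρ : RF) (v : List Bool) :
    Function.update (mk ρ) .sat v = mk { ρ with sat := v } := by
  funext i; cases i <;> rfl

/-- updating register `ls`. [folklore] -/
@[simp] theorem update_mk_ls (ρ : RF) (v : List Bool) :
    Function.update (mk ρ) .ls v = mk { ρ with ls := v } := by
  funext i; cases i <;> rfl

/-- updating register `he`. [folklore] -/
@[simp] theorem update_mk_he (ρ : RF) (v : List Bool) :
    Function.update (mk ρ) .he v = mk { ρ with he := v } := by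
  funext i; cases i <;> rfl

/-- updating register `md`. [folklore] -/
@[simp] theorem update_mk_md (ρ : RF) (v : List Bool) :
    Function.update (mk ρ) .md v = mk { ρ with md := v } := by
  funext i; cases i <;> rfl

/-- updating register `bu`. [folklore] -/
@[simp] theorem update_mk_bu (ρ : RF) (v : List Bool) :
    Function.update (mk ρ) .bu v = mk { ρ with bu := v } := by
  funext i; cases i <;> rfl

/-- updating register `hd`. [folklore] -/
@[simp] theorem update_mk_hd (ρ : RF) (v : List Bool) :
    Function.update (mk ρ) .hd v = mk { ρ with hd := v } := by
  funext i; cases i <;> rfl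

/-- updating register `uu`. [folklore] -/
@[simp] theorem update_mk_uu (ρ : RF) (v : List Bool) :
    Function.update (mk ρ) .uu v = mk { ρ with uu := v } := by
  funext i; cases i <;> rfl

/-- updating register `cc`. [folklore] -/
@[simp] theorem update_mk_cc (ρ : RF) (v : List Bool) :
    Function.update (mk ρ) .cc v = mk { ρ with cc := v } := by
  funext i; cases i <;> rfl

/-- updating register `tt`. [folklore] -/
@[simp] theorem update_mk_tt (ρ : RF) (v : List Bool) :
    Function.update (mk ρ) .tt v = mk { ρ with tt := v } := by
  funext i; cases i <;> rfl

/-- updating register `out`. [folklore] -/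
@[simp] theorem update_mk_out (ρ : RF) (v : List Bool) :
    Function.update (mk ρ) .out v = mk { ρ with out := v } := by
  funext i; cases i <;> rfl


/-- The initial register file of the machine: the input word in `w`. [folklore] -/
theorem init_w (z : List Bool) : Regs.init R.w z = mk { RF.zero with w := z } := by
  funext i; cases i <;> rfl

/-- The final register file of the machine: the answer in `out`. [folklore] -/
theorem init_out (z : List Bool) : Regs.init R.out z = mk { RF.zero with out := z } := by
  funext i; cases i <;> rfl

/-! ### Writing and reading tokens -/

/-- Emit the code of a token on register `k` (by the generic `GenProg.pushes`: push the bits in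
order, so that `k` receives the reversed code on top). [folklore] -/
def emit (k : R) (t : Tok) : Com R := GenProg.pushes k t.code

/-- Effect of `emit`, within `5` steps. [folklore] -/
theorem runs_emit (k : R) (t : Tok) (Rg : Regs R) :
    Runs (emit k t) Rg (Function.update Rg k (t.code.reverse ++ Rg k)) 5 :=
  (GenProg.runs_pushes k t.code Rg).mono t.length_code_le

/-- Set a flag register (content `[]` or `[true]`) to `[true]`. [folklore] -/
def setFlag (k : R) : Com R := .pop k (.push k true) (.push k true) (.push k true)

/-- Effect of `setFlag` on a flag register, within `3` steps. [folklore] -/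
theorem runs_setFlag (k : R) (Rg : Regs R) (h : Rg k = [] ∨ Rg k = [true]) :
    Runs (setFlag k) Rg (Function.update Rg k [true]) 3 := by
  rcases h with h | h
  · refine (Runs.pop_nil _ _ h ((Runs.push k true Rg).mono (Nat.le_refl 1))).of_eq ?_ (by omega)
    simp [h]
  · refine (Runs.pop_true _ _ h ((Runs.push k true _).mono (Nat.le_refl 1))).of_eq ?_ (by omega)
    simp

/-- Token handlers: what to run after a token of each kind has been read (and for a malformed
code). [folklore] -/
structure Handlers where
  /-- after an index bit -/
  onBit : Bool → Com R
  /-- after a literal start -/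
  onPol : Bool → Com R
  /-- after an end of literal -/
  onEndl : Com R
  /-- after an end of clause -/
  onEndc : Com R
  /-- after an end of formula -/
  onEndf : Com R
  /-- after a budget unit -/
  onUnit : Com R
  /-- on a malformed code (never reached on well-formed registers) -/
  onJunk : Com R

/-- The handler of a token. [folklore] -/
def Handlers.run (H : Handlers) : Tok → Com R
  | .bit b => H.onBit b
  | .pol b => H.onPol b
  | .endl => H.onEndl
  | .endc => H.onEndc
  | .endf => H.onEndf
  | .unit => H.onUnit

/-- The token reader after the first code bit `b₀` has been popped from `k`: pop the remaining
bits of the prefix code (`1b`, `01b`, `001`, `0000`, `00010`, `00011`) and dispatch. [folklore] -/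
def tokCase (k : R) (H : Handlers) : Bool → Com R
  | true => .pop k (H.onBit true) (H.onBit false) H.onJunk
  | false => .pop k (.pop k (H.onPol true) (H.onPol false) H.onJunk)
      (.pop k H.onEndl (.pop k (.pop k H.onUnit H.onEndf H.onJunk) H.onEndc H.onJunk) H.onJunk)
      H.onJunk

/-- The token loop over register `k`: read tokens and dispatch until `k` is empty. [folklore] -/
def tokLoop (k : R) (H : Handlers) : Com R :=
  .loop k (tokCase k H true) (tokCase k H false)

/-- The first code bit and the remaining code bits of a token. [folklore] -/
def Tok.hd : Tok → Bool
  | .bit _ => true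
  | _ => false

/-- The remaining code bits of a token. [folklore] -/
def Tok.tl : Tok → List Bool
  | .bit b => [b]
  | .pol b => [true, b]
  | .endl => [false, true]
  | .endc => [false, false, false]
  | .endf => [false, false, true, false]
  | .unit => [false, false, true, true]

/-- The code is the first bit followed by the remaining bits. [folklore] -/
theorem Tok.code_eq (t : Tok) : t.code = t.hd :: t.tl := by
  cases t <;> rfl

/-- **One token.** If register `k` holds the remaining code bits of `t` followed by `rest`, the
reader `tokCase k H t.hd` pops them (two steps each) and runs the handler of `t` on the file
with `k := rest`. [folklore] -/
theorem runs_tokCase {k : R} {H : Handlers} {t : Tok} {rest : List Bool} {Rg R' : Regs R}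
    {B : ℕ} (hk : Rg k = t.tl ++ rest) (h : Runs (H.run t) (Function.update Rg k rest) R' B) :
    Runs (tokCase k H t.hd) Rg R' (B + 2 * t.tl.length) := by
  cases t with
  | bit b =>
    change Runs (H.onBit b) _ _ _ at h
    cases b
    · exact Runs.pop_false _ _ hk h
    · exact Runs.pop_true _ _ hk h
  | pol b =>
    change Runs (H.onPol b) _ _ _ at h
    have hk' : Function.update Rg k (b :: rest) k = b :: rest := by simp
    have h' : Runs (H.onPol b) (Function.update (Function.update Rg k (b :: rest)) k rest) R' B := by
      simpa using h
    have : Runs (tokCase k H (Tok.pol b).hd) Rg R' (B + 2 + 2) := by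
      refine Runs.pop_true _ _ hk ?_
      cases b
      · exact Runs.pop_false _ _ hk' h'
      · exact Runs.pop_true _ _ hk' h'
    exact this.mono (by simp [Tok.tl])
  | endl =>
    change Runs H.onEndl _ _ _ at h
    have hk' : Function.update Rg k (true :: rest) k = true :: rest := by simp
    have h' : Runs H.onEndl (Function.update (Function.update Rg k (true :: rest)) k rest) R' B := by
      simpa using h
    have : Runs (tokCase k H Tok.endl.hd) Rg R' (B + 2 + 2) :=
      Runs.pop_false _ _ hk (Runs.pop_true _ _ hk' h')
    exact this.mono (by simp [Tok.tl])
  | endc =>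
    change Runs H.onEndc _ _ _ at h
    have hk1 : Function.update Rg k (false :: false :: rest) k = false :: false :: rest := by simp
    have hk2 : Function.update (Function.update Rg k (false :: false :: rest)) k (false :: rest) k =
        false :: rest := by simp
    have h' : Runs H.onEndc (Function.update (Function.update (Function.update Rg k
        (false :: false :: rest)) k (false :: rest)) k rest) R' B := by
      simpa using h
    have : Runs (tokCase k H Tok.endc.hd) Rg R' (B + 2 + 2 + 2) :=
      Runs.pop_false _ _ hk (Runs.pop_false _ _ hk1 (Runs.pop_false _ _ hk2 h'))
    exact this.mono (by simp [Tok.tl])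
  | endf =>
    change Runs H.onEndf _ _ _ at h
    have hk1 : Function.update Rg k (false :: true :: false :: rest) k = false :: true :: false :: rest := by
      simp
    have hk2 : Function.update (Function.update Rg k (false :: true :: false :: rest)) k
        (true :: false :: rest) k = true :: false :: rest := by simp
    have hk3 : Function.update (Function.update (Function.update Rg k
        (false :: true :: false :: rest)) k (true :: false :: rest)) k (false :: rest) k =
        false :: rest := by simp
    have h' : Runs H.onEndf (Function.update (Function.update (Function.update (Function.update Rg k
        (false :: true :: false :: rest)) k (true :: false :: rest)) k (false :: rest)) k rest) R' B := by
      simpa using h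
    have : Runs (tokCase k H Tok.endf.hd) Rg R' (B + 2 + 2 + 2 + 2) :=
      Runs.pop_false _ _ hk (Runs.pop_false _ _ hk1 (Runs.pop_true _ _ hk2
        (Runs.pop_false _ _ hk3 h')))
    exact this.mono (by simp [Tok.tl])
  | unit =>
    change Runs H.onUnit _ _ _ at h
    have hk1 : Function.update Rg k (false :: true :: true :: rest) k = false :: true :: true :: rest := by
      simp
    have hk2 : Function.update (Function.update Rg k (false :: true :: true :: rest)) k
        (true :: true :: rest) k = true :: true :: rest := by simp
    have hk3 : Function.update (Function.update (Function.update Rg k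
        (false :: true :: true :: rest)) k (true :: true :: rest)) k (true :: rest) k =
        true :: rest := by simp
    have h' : Runs H.onUnit (Function.update (Function.update (Function.update (Function.update Rg k
        (false :: true :: true :: rest)) k (true :: true :: rest)) k (true :: rest)) k rest) R' B := by
      simpa using h
    have : Runs (tokCase k H Tok.unit.hd) Rg R' (B + 2 + 2 + 2 + 2) :=
      Runs.pop_false _ _ hk (Runs.pop_false _ _ hk1 (Runs.pop_true _ _ hk2
        (Runs.pop_true _ _ hk3 h')))
    exact this.mono (by simp [Tok.tl])

/-- **One token, inside the loop.** If register `k` holds the code of `t` followed by `rest`,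
one round of `tokLoop k H` runs the handler of `t` on the file with `k := rest`, and the loop
continues from the resulting file. [folklore] -/
theorem runs_tokLoop_cons {k : R} {H : Handlers} {t : Tok} {rest : List Bool} {Rg R₁ R₂ : Regs R}
    {B₁ B₂ : ℕ} (hk : Rg k = t.code ++ rest) (h₁ : Runs (H.run t) (Function.update Rg k rest) R₁ B₁)
    (h₂ : Runs (tokLoop k H) R₁ R₂ B₂) : Runs (tokLoop k H) Rg R₂ (B₁ + 10 + B₂) := by
  rw [Tok.code_eq] at hk
  have hmid : Runs (tokCase k H t.hd) (Function.update Rg k (t.tl ++ rest)) R₁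
      (B₁ + 2 * t.tl.length) :=
    runs_tokCase (rest := rest) (Rg := Function.update Rg k (t.tl ++ rest)) (by simp)
      (by simpa using h₁)
  have hlen : t.tl.length ≤ 4 := by cases t <;> simp [Tok.tl]
  have hmid' := hmid.mono (show B₁ + 2 * t.tl.length ≤ B₁ + 8 by omega)
  cases ht : t.hd
  · rw [ht] at hk hmid'
    exact (Runs.loop_false hk hmid' h₂).mono (by omega)
  · rw [ht] at hk hmid'
    exact (Runs.loop_true hk hmid' h₂).mono (by omega)

/-- The token loop on an empty register exits in one step. [folklore] -/
theorem runs_tokLoop_nil {k : R} {H : Handlers} {Rg : Regs R} (hk : Rg k = []) :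
    Runs (tokLoop k H) Rg Rg 1 :=
  Runs.loop_nil _ _ hk

/-! ### Token loops driven by a functional specification -/

section Spec

variable (S : Tok → RF → RF) (setk : RF → List Bool → RF) (cost : Tok → RF → ℕ)

/-- The register file after the token loop has processed `ts`, when every handler acts as
`S t` on named files and the loop register is set by `setk`: before the handler of `t` runs,
the loop register holds the code of the remaining tokens. [folklore] -/
def specFold : List Tok → RF → RF
  | [], ρ => ρ
  | t :: ts, ρ => specFold ts (S t (setk ρ (bits ts)))

/-- The cost of the token loop along the trajectory of `specFold`: `10` steps of reading per
token, the handler costs, and the final exit step. [folklore] -/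
def costFold : List Tok → RF → ℕ
  | [], _ => 1
  | t :: ts, ρ => cost t (setk ρ (bits ts)) + 10 + costFold ts (S t (setk ρ (bits ts)))

variable {S setk cost}

/-- **The token loop follows its specification.** If every handler, on files satisfying an
invariant `P` (stable under the handlers and under setting the loop register `k`), acts as
`S t` within `cost t` steps and leaves `k` alone, then on a file whose register `k` holds the
code of `ts` the loop `tokLoop k H` ends in `specFold S setk ts` within `costFold` steps.
[Nipkow–Klein 2014, §7.2 (rule induction on loops)] [folklore] -/
theorem runs_tokLoop_of_spec {k : R} {H : Handlers} {P : RF → Prop}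
    (hsetk : ∀ ρ l, mk (setk ρ l) = Function.update (mk ρ) k l)
    (hrun : ∀ t ρ, P ρ → Runs (H.run t) (mk ρ) (mk (S t ρ)) (cost t ρ))
    (hP : ∀ t ρ, P ρ → P (S t ρ)) (hk : ∀ t ρ, P ρ → mk (S t ρ) k = mk ρ k)
    (hPk : ∀ ρ l, P ρ → P (setk ρ l)) :
    ∀ (ts : List Tok) (ρ : RF), P ρ → mk ρ k = bits ts →
      Runs (tokLoop k H) (mk ρ) (mk (specFold S setk ts ρ)) (costFold S setk cost ts ρ) := by
  intro ts
  induction ts with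
  | nil =>
    intro ρ _ hkρ
    exact runs_tokLoop_nil (by simpa using hkρ)
  | cons t ts ih =>
    intro ρ hρ hkρ
    rw [bits_cons] at hkρ
    have hρ' : P (setk ρ (bits ts)) := hPk ρ _ hρ
    have h₁ : Runs (H.run t) (Function.update (mk ρ) k (bits ts)) (mk (S t (setk ρ (bits ts))))
        (cost t (setk ρ (bits ts))) := by
      rw [← hsetk]; exact hrun t _ hρ'
    have h₂ := ih (S t (setk ρ (bits ts))) (hP t _ hρ') (by rw [hk t _ hρ', hsetk]; simp)
    exact (runs_tokLoop_cons hkρ h₁ h₂).of_eq rfl (by simp only [costFold]; omega)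

/-- **Cost of a token loop from a potential.** If, on files satisfying an invariant `P`
(stable under the handlers and under setting the loop register), the handler costs are affine
in a potential `tot` which grows by at most `γ` per token (and does not grow when the loop
register is set), the loop costs at most `|ts| · (α (tot ρ + γ |ts|) + β + 10) + 1`. [folklore] -/
theorem costFold_le {P : RF → Prop} (tot : RF → ℕ) (α β γ : ℕ)
    (hcost : ∀ t ρ, P ρ → cost t ρ ≤ α * tot ρ + β)
    (htot : ∀ t ρ, P ρ → tot (S t ρ) ≤ tot ρ + γ) (hset : ∀ ρ l, tot (setk ρ l) ≤ tot ρ)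
    (hP : ∀ t ρ, P ρ → P (S t ρ)) (hPk : ∀ ρ l, P ρ → P (setk ρ l)) :
    ∀ (ts : List Tok) (ρ : RF), P ρ →
      costFold S setk cost ts ρ ≤ ts.length * (α * (tot ρ + γ * ts.length) + β + 10) + 1 := by
  intro ts
  induction ts with
  | nil => intro ρ _; simp [costFold]
  | cons t ts ih =>
    intro ρ hρ
    rw [costFold]
    have hρ' := hPk ρ (bits ts) hρ
    have h1 := hcost t (setk ρ (bits ts)) hρ'
    have h2 := hset ρ (bits ts)
    have h3 := ih (S t (setk ρ (bits ts))) (hP t _ hρ')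
    have h4 := htot t (setk ρ (bits ts)) hρ'
    have h5 : α * tot (setk ρ (bits ts)) ≤ α * tot ρ := Nat.mul_le_mul_left α h2
    have h6 : ts.length * (α * (tot (S t (setk ρ (bits ts))) + γ * ts.length) + β + 10) ≤
        ts.length * (α * (tot ρ + γ * (ts.length + 1)) + β + 10) := by
      apply Nat.mul_le_mul_left
      have : tot (S t (setk ρ (bits ts))) + γ * ts.length ≤ tot ρ + γ * (ts.length + 1) := by
        rw [Nat.mul_succ]; omega
      have := Nat.mul_le_mul_left α this
      omega
    have h7 : α * tot ρ ≤ α * (tot ρ + γ * (ts.length + 1)) := Nat.mul_le_mul_left α (by omega)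
    simp only [List.length_cons]
    rw [Nat.succ_mul]
    omega

/-- If the handlers commute with setting the loop register, so does their iteration. [folklore] -/
theorem foldl_setk_comm (hS : ∀ t ρ l, S t (setk ρ l) = setk (S t ρ) l) :
    ∀ (ts : List Tok) (ρ : RF) (l : List Bool),
      ts.foldl (fun ρ t => S t ρ) (setk ρ l) = setk (ts.foldl (fun ρ t => S t ρ) ρ) l := by
  intro ts
  induction ts with
  | nil => intro ρ l; rfl
  | cons t ts ih => intro ρ l; simp only [List.foldl_cons, hS, ih]

/-- **`specFold` as a left fold**: if the handlers commute with setting the loop register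
(and setting it twice is setting it once), the loop's final file is the left fold of the
handlers' specifications, with the loop register emptied. [folklore] -/
theorem specFold_eq_foldl (hS : ∀ t ρ l, S t (setk ρ l) = setk (S t ρ) l)
    (hkk : ∀ ρ l l', setk (setk ρ l) l' = setk ρ l') :
    ∀ (ts : List Tok) (ρ : RF),
      specFold S setk ts (setk ρ (bits ts)) = setk (ts.foldl (fun ρ t => S t ρ) ρ) [] := by
  intro ts
  induction ts with
  | nil => intro ρ; rfl
  | cons t ts ih =>
    intro ρ
    rw [specFold, hkk, hS, ih, List.foldl_cons]

end Spec


/-! ### Pass 1: extracting the top formula of the worklist -/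

/-- Handler of the extraction pass over the worklist `w`: before the first `endf` (mode
`md = []`) budget units are counted in `bu` and the other tokens are copied to `fr`, the `endf`
switches the mode (`md = [true]`), after it tokens are copied to the stash `w2`. [folklore] -/
def extractTok (t : Tok) : Com R :=
  .pop .md (.push .md true ;; emit .w2 t) (emit .fr t)
    (if t = .endf then .push .md true else if t = .unit then .push .bu true else emit .fr t)

/-- The handlers of the extraction pass. [folklore] -/
def extractH : Handlers :=
  ⟨fun b => extractTok (.bit b), fun b => extractTok (.pol b), extractTok .endl,
    extractTok .endc, extractTok .endf, extractTok .unit, .skip⟩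

/-- The extraction handlers by token. [folklore] -/
@[simp] theorem extractH_run (t : Tok) : extractH.run t = extractTok t := by
  cases t <;> rfl

/-! ### Pass 2: scanning the formula -/

/-- Handler of the scan pass over the current formula `f`: every token is copied to `f2r`; the
mode `md` is `[]` before the first literal, `[true]` inside the first literal (whose index bits
go to `xr`), `[false]` afterwards; `ls` records that the current clause has a literal, and an
`endc` with `ls` unset raises `he` (empty clause). [folklore] -/
def scanTok : Tok → Com R
  | .pol b => emit .f2r (.pol b) ;; .pop .md (.push .md true) (.push .md false) (.push .md true) ;;
      setFlag .ls
  | .bit b => emit .f2r (.bit b) ;; .pop .md (.push .md true ;; .push .xr b) (.push .md false) .skip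
  | .endl => emit .f2r .endl ;; .pop .md (.push .md false) (.push .md false) .skip
  | .endc => emit .f2r .endc ;; .pop .ls .skip .skip (setFlag .he)
  | .endf => emit .f2r .endf
  | .unit => .skip

/-- The handlers of the scan pass. [folklore] -/
def scanH : Handlers :=
  ⟨fun b => scanTok (.bit b), fun b => scanTok (.pol b), scanTok .endl, scanTok .endc,
    scanTok .endf, scanTok .unit, .skip⟩

/-- The scan handlers by token. [folklore] -/
@[simp] theorem scanH_run (t : Tok) : scanH.run t = scanTok t := by
  cases t <;> rfl

/-- The scan pass: the token loop, then reset the mode and the literal flag. [folklore] -/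
def scan : Com R := tokLoop .f scanH ;; clear .md ;; clear .ls

/-! ### Pass 3: restriction `F[x := v]` -/

/-- Handler of the restriction pass with value `v` (copying every token to `f3r` if `cp`):
a literal start records the polarity in `pb`, resets the mismatch flag and reloads the pivot
into `xc`; index bits are compared with `xc` (a difference, or `xc` exhausted, raises `mis`);
at the end of the literal (`xc` must be exhausted too) a literal on another variable is moved
from `lb` to the clause buffer `cb`, a literal on the pivot is deleted and, if its polarity is
`v`, marks the clause satisfied (`sat`); at the end of the clause a satisfied clause is
discarded, another one is emitted to `o` (its kept literals in reverse order) with its `endc`.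
[Davis–Logemann–Loveland 1962, splitting rule] [folklore] -/
def restrictTok (v cp : Bool) (t : Tok) : Com R :=
  (if cp then emit .f3r t else .skip) ;;
  match t with
  | .pol b => clear .pb ;; .push .pb b ;; clear .mis ;; clear .xc ;; copy .x .xc .t .u ;;
      emit .lb (.pol b)
  | .bit b => emit .lb (.bit b) ;;
      .pop .xc (if b then .skip else setFlag .mis) (if b then setFlag .mis else .skip) (setFlag .mis)
  | .endl => emit .lb .endl ;;
      .pop .xc (setFlag .mis ;; clear .xc) (setFlag .mis ;; clear .xc) .skip ;;
      .pop .mis (pour .lb .cb) (pour .lb .cb)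
        (clear .lb ;; .pop .pb (if v then setFlag .sat else .skip)
          (if v then .skip else setFlag .sat) .skip)
  | .endc => .pop .sat (clear .cb) (clear .cb) (pour .cb .o ;; emit .o .endc)
  | .endf => .skip
  | .unit => .skip

/-- The handlers of the restriction pass. [folklore] -/
def restrictH (v cp : Bool) : Handlers :=
  ⟨fun b => restrictTok v cp (.bit b), fun b => restrictTok v cp (.pol b), restrictTok v cp .endl,
    restrictTok v cp .endc, restrictTok v cp .endf, restrictTok v cp .unit, .skip⟩

/-- The restriction handlers by token. [folklore] -/
@[simp] theorem restrictH_run (v cp : Bool) (t : Tok) : (restrictH v cp).run t = restrictTok v cp t := by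
  cases t <;> rfl

/-- The restriction pass over the source register `src`: the token loop, then reset the
polarity, the pivot copy and the mismatch flag. [folklore] -/
def restrictPass (v cp : Bool) (src : R) : Com R :=
  tokLoop src (restrictH v cp) ;; clear .pb ;; clear .xc ;; clear .mis

/-! ### The prelude: the budget `⌊min(n, N·cap)/N⌋` in unary -/

/-- Handler of the header pass over the input `w` (parameter `N`): in the header (mode
`md = []`) the bits of `numVars` are stacked on `hd` (most significant on top) and the closing
`endl` switches the mode; afterwards every token is copied to `fr`, and every literal start
adds `N` capacity units to `cc`. [folklore] -/
def hdrTok (N : ℕ) (t : Tok) : Com R :=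
  .pop .md
    (.push .md true ;; emit .fr t ;;
      (match t with | .pol _ => GenProg.pushes .cc (List.replicate N true) | _ => .skip))
    (emit .fr t)
    (match t with
      | .bit b => .push .hd b
      | .endl => .push .md true
      | _ => .skip)

/-- The handlers of the header pass. [folklore] -/
def hdrH (N : ℕ) : Handlers :=
  ⟨fun b => hdrTok N (.bit b), fun b => hdrTok N (.pol b), hdrTok N .endl, hdrTok N .endc,
    hdrTok N .endf, hdrTok N .unit, .skip⟩

/-- The header handlers by token. [folklore] -/
@[simp] theorem hdrH_run (N : ℕ) (t : Tok) : (hdrH N).run t = hdrTok N t := by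
  cases t <;> rfl

/-- One unit of the saturating doubling: a unit goes to `uu`, and one more if the capacity
`cc` is not exhausted. [folklore] -/
def dstep : Com R := .push .uu true ;; .pop .cc (.push .uu true) (.push .uu true) .skip

/-- Add one unit if the capacity is not exhausted. [folklore] -/
def addOne : Com R := .pop .cc (.push .uu true) (.push .uu true) .skip

/-- The body of the doubling loop for the header bit `b` (most significant first):
`u := min(2u + b, S)` on the unary accumulator `uu` with capacity `cc` (`u + c = S`). [folklore] -/
def dblBody (b : Bool) : Com R :=
  pour .uu .tt ;; .loop .tt dstep dstep ;; (if b then addOne else .skip)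

/-- Pop `j` further units of `uu`, then run `d`; if `uu` runs short, run `s`. [folklore] -/
def popK : ℕ → Com R → Com R → Com R
  | 0, d, _ => d
  | j + 1, d, s => .pop .uu (popK j d s) (popK j d s) s

/-- The body of the grouping loop (after the loop popped one unit): pop `N - 1` more units and
emit one budget unit onto the worklist; a short group is discarded. [folklore] -/
def grpBody (N : ℕ) : Com R := popK (N - 1) (GenProg.pushes .w Tok.unit.code.reverse) .skip

/-- **The prelude** (parameter `N ≥ 1`): from the input `code(header) code(F)` in `w` to the
initial worklist `unit^q code(F) endf` with `q = ⌊min(n, N (m + 1)) / N⌋`, `m` the number of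
literals of `F` (so `q = min(⌊n/N⌋, m + 1)` up to the saturation, and `m + 1` exceeds the
number of variables). [cite: ImpagliazzoPaturiJCSS2001, p. 370 (threshold δn, δ = 1/N)] -/
def prelude (N : ℕ) : Com R :=
  tokLoop .w (hdrH N) ;; clear .md ;; GenProg.pushes .cc (List.replicate N true) ;;
  .loop .hd (dblBody true) (dblBody false) ;;
  GenProg.pushes .w Tok.endf.code.reverse ;; pour .fr .w ;;
  .loop .uu (grpBody N) (grpBody N) ;; clear .cc

/-! ### The program -/

/-- A formula without clauses has been popped: clean the stash and the budget, answer `true`,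
stop. [folklore] -/
def found : Com R := clear .w2 ;; clear .bu ;; .push .out true ;; .halt

/-- Push one budget unit onto the worklist. [folklore] -/
def pushUnit : Com R := GenProg.pushes .w Tok.unit.code.reverse

/-- Splitting with budget `b` (in `bu`): restore the rest of the worklist; if `b ≥ 1`, prepend
`F[x := true]` with budget `b - 1` (first restriction pass over `f2`, keeping a copy of the
formula in `f3r`; the `b - 1` units are copied from `bu`), else just move the formula to `f3r`;
then prepend `F[x := false]` with budget `b` (second pass over `f3`, the units drained from
`bu`); forget the pivot. [cite: ImpagliazzoPaturiJCSS2001, p. 370; Davis–Logemann–Loveland 1962] -/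
def splitStep : Com R :=
  pour .w2 .w ;;
  .pop .bu
    (.push .bu true ;; restrictPass true true .f2 ;; emit .o .endf ;; pour .o .w ;;
      copy .bu .tt .t .u ;; .pop .tt .skip .skip .skip ;; .loop .tt pushUnit pushUnit)
    (.push .bu true ;; restrictPass true true .f2 ;; emit .o .endf ;; pour .o .w ;;
      copy .bu .tt .t .u ;; .pop .tt .skip .skip .skip ;; .loop .tt pushUnit pushUnit)
    (pour .f2 .f3r) ;;
  pour .f3r .f3 ;;
  restrictPass false false .f3 ;; emit .o .endf ;; pour .o .w ;;
  .loop .bu pushUnit pushUnit ;;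
  clear .x

/-- One iteration of the worklist loop, after the loop has popped the first bit `b₀` of `w`:
extract the top entry (budget to `bu`, formula to `f`) and stash the rest; an empty formula is
satisfiable (`found`); otherwise scan it; a formula with an empty clause is dropped (restore
the rest, forget the budget); otherwise split. [Davis–Logemann–Loveland 1962] [folklore] -/
def body (b₀ : Bool) : Com R :=
  tokCase .w extractH b₀ ;; tokLoop .w extractH ;; clear .md ;;
  pour .fr .f ;;
  .pop .f (.push .f true) (.push .f false) found ;;
  scan ;; pour .f2r .f2 ;; pour .xr .x ;;
  .pop .he (clear .f2 ;; clear .x ;; clear .bu ;; pour .w2 .w)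
    (clear .f2 ;; clear .x ;; clear .bu ;; pour .w2 .w) splitStep

/-- The worklist loop. [folklore] -/
def mainLoop : Com R := .loop .w (body true) (body false)

/-- **The search program** (parameter `N`): compute the budget and lay out the initial worklist
(`prelude`), run the worklist loop; if it runs out of work, answer `false`.
[cite: ImpagliazzoPaturiJCSS2001, p. 370 (exhaustive search of light assignments)] -/
def searchProg (N : ℕ) : Com R :=
  prelude N ;; mainLoop ;; .push .out false





/-! ### Pass 1: extraction -/

/-- Setting the worklist register. [folklore] -/
def setW (ρ : RF) (l : List Bool) : RF := { ρ with w := l }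

/-- `setW` is the update of `w`. [folklore] -/
@[simp] theorem mk_setW (ρ : RF) (l : List Bool) : mk (setW ρ l) = Function.update (mk ρ) .w l := by
  simp [setW]

/-- Invariant of the extraction pass: the mode is a flag. [folklore] -/
def exP (ρ : RF) : Prop := ρ.md = [] ∨ ρ.md = [true]

/-- Specification of the extraction handler. [folklore] -/
def exS (t : Tok) (ρ : RF) : RF :=
  if ρ.md = [true] then { ρ with w2 := t.code.reverse ++ ρ.w2 }
  else if t = .endf then { ρ with md := [true] }
  else if t = .unit then { ρ with bu := true :: ρ.bu }
  else { ρ with fr := t.code.reverse ++ ρ.fr }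

/-- **The extraction handler follows its specification**, within `8` steps. [folklore] -/
theorem runs_extractTok (t : Tok) (ρ : RF) (hρ : exP ρ) :
    Runs (extractTok t) (mk ρ) (mk (exS t ρ)) 8 := by
  rcases hρ with h | h
  · -- before the first `endf`
    by_cases ht : t = .endf
    · subst ht
      refine (Runs.pop_nil _ _ (by simp [h]) ((Runs.push R.md true (mk ρ)).mono
        (Nat.le_refl 1))).of_eq ?_ (by omega)
      simp [exS, h]
    · by_cases hu : t = .unit
      · subst hu
        refine (Runs.pop_nil _ _ (by simp [h]) ((Runs.push R.bu true (mk ρ)).mono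
          (Nat.le_refl 1))).of_eq ?_ (by omega)
        simp [exS, h]
      · have : extractTok t = .pop .md (.push .md true ;; emit .w2 t) (emit .fr t) (emit .fr t) := by
          simp [extractTok, ht, hu]
        rw [this]
        refine (Runs.pop_nil _ _ (by simp [h]) (runs_emit R.fr t (mk ρ))).of_eq ?_ (by omega)
        simp [exS, h, ht, hu]
  · -- after it
    refine (Runs.pop_true' _ _ (by simp [h]) (update_mk_md ρ [])
      ((Runs.push R.md true _).seq (runs_emit R.w2 t _))).of_eq ?_ (by omega)
    simp [exS, h]

/-- The invariant is stable under the handler. [folklore] -/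
theorem exP_exS (t : Tok) (ρ : RF) (hρ : exP ρ) : exP (exS t ρ) := by
  rcases hρ with h | h
  · by_cases ht : t = .endf
    · right; simp [exS, h, ht]
    · by_cases hu : t = .unit
      · left; simp [exS, h, hu]
      · left; simp [exS, h, ht, hu]
  · right; simp [exS, h]

/-- The handler leaves the worklist register alone. [folklore] -/
theorem exS_w (t : Tok) (ρ : RF) : (exS t ρ).w = ρ.w := by
  unfold exS; split_ifs <;> rfl

/-- **The extraction loop follows its specification.** [folklore] -/
theorem runs_extractLoop (ts : List Tok) (ρ : RF) (hρ : exP ρ) (hw : ρ.w = bits ts) :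
    Runs (tokLoop .w extractH) (mk ρ) (mk (specFold exS setW ts ρ))
      (costFold exS setW (fun _ _ => 8) ts ρ) :=
  runs_tokLoop_of_spec (k := .w) (H := extractH) (P := exP) mk_setW
    (fun t ρ h => by simpa using runs_extractTok t ρ h) exP_exS
    (fun t ρ _ => by simp [exS_w]) (fun ρ l h => by simpa [exP, setW] using h) ts ρ hρ
    (by simpa using hw)

/-- Cost of the extraction loop: `18 |ts| + 1`. [folklore] -/
theorem costFold_exS_le (ts : List Tok) (ρ : RF) :
    costFold exS setW (fun _ _ => 8) ts ρ ≤ 18 * ts.length + 1 := by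
  have := costFold_le (S := exS) (setk := setW) (cost := fun _ _ => 8) (P := fun _ => True)
    (fun _ => 0) 0 8 0 (fun _ _ _ => by simp) (fun _ _ _ => by simp) (fun _ _ => by simp)
    (fun _ _ _ => trivial) (fun _ _ _ => trivial) ts ρ trivial
  simpa [Nat.mul_comm] using this

/-- **Closed form of the extraction, after the `endf`**: in mode `[true]` all tokens go to the
stash. [folklore] -/
theorem specFold_exS_after (ts : List Tok) (ρ : RF) (h : ρ.md = [true]) (hw : ρ.w = bits ts) :
    specFold exS setW ts ρ = { ρ with w := [], w2 := (bits ts).reverse ++ ρ.w2 } := by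
  induction ts generalizing ρ with
  | nil => cases ρ; simp only [bits_nil] at hw; subst hw; simp [specFold]
  | cons t ts ih =>
    rw [specFold, ih _ (by simp [exS, setW, h]) (by simp [exS, setW, h])]
    simp [exS, setW, h]

/-- **Closed form of the extraction**: in mode `[]`, on `A ++ [endf] ++ B` with no `endf` in
`A`, the tokens of `A` go to `fr` (reversed code), those of `B` to `w2`, and the mode ends
`[true]`. [folklore] -/
theorem specFold_exS (A B : List Tok) (hA : Tok.endf ∉ A) (hA' : Tok.unit ∉ A) (ρ : RF)
    (h : ρ.md = []) (hw : ρ.w = bits (A ++ Tok.endf :: B)) :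
    specFold exS setW (A ++ Tok.endf :: B) ρ =
      { ρ with w := [], fr := (bits A).reverse ++ ρ.fr, w2 := (bits B).reverse ++ ρ.w2,
               md := [true] } := by
  induction A generalizing ρ with
  | nil =>
    rw [List.nil_append, specFold, specFold_exS_after _ _ (by simp [exS, setW, h])
      (by simp [exS, setW, h])]
    simp [exS, setW, h]
  | cons t A ih =>
    have ht : t ≠ .endf := fun e => hA (e ▸ List.mem_cons_self)
    have hu : t ≠ .unit := fun e => hA' (e ▸ List.mem_cons_self)
    have hA1 : Tok.endf ∉ A := fun e => hA (List.mem_cons_of_mem _ e)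
    have hA2 : Tok.unit ∉ A := fun e => hA' (List.mem_cons_of_mem _ e)
    rw [List.cons_append, specFold, ih hA1 hA2 _ (by simp [exS, setW, h, ht, hu])
      (by simp [exS, setW, h, ht, hu])]
    simp [exS, setW, h, ht, hu]

/-- **Closed form of the extraction on a leading block of budget units**: they are counted in
`bu` (the rest of the token string must be nonempty — it always ends with `endf`). [folklore] -/
theorem specFold_exS_units (b : ℕ) (t : Tok) (ts : List Tok) (ρ : RF) (h : ρ.md = []) :
    specFold exS setW (List.replicate b Tok.unit ++ t :: ts) ρ =
      specFold exS setW (t :: ts) { ρ with bu := List.replicate b true ++ ρ.bu } := by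
  induction b generalizing ρ with
  | zero => rfl
  | succ b ih =>
    rw [List.replicate_succ, List.cons_append, specFold, ih _ (by simp [exS, setW, h])]
    simp only [specFold, setW, exS, h]
    simp [List.replicate_succ']

/-! ### Pass 2: scan -/

/-- Setting the formula register. [folklore] -/
def setF (ρ : RF) (l : List Bool) : RF := { ρ with f := l }

/-- `setF` is the update of `f`. [folklore] -/
@[simp] theorem mk_setF (ρ : RF) (l : List Bool) : mk (setF ρ l) = Function.update (mk ρ) .f l := by
  simp [setF]

/-- Invariant of the scan pass: mode and flags are well formed. [folklore] -/
def scP (ρ : RF) : Prop :=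
  (ρ.md = [] ∨ ρ.md = [true] ∨ ρ.md = [false]) ∧ (ρ.ls = [] ∨ ρ.ls = [true]) ∧
    (ρ.he = [] ∨ ρ.he = [true])

/-- Specification of the scan handler. [folklore] -/
def scS : Tok → RF → RF
  | .pol b, ρ => { ρ with f2r := (Tok.pol b).code.reverse ++ ρ.f2r,
                          md := if ρ.md = [false] then [false] else [true], ls := [true] }
  | .bit b, ρ => if ρ.md = [true] then
                   { ρ with f2r := (Tok.bit b).code.reverse ++ ρ.f2r, xr := b :: ρ.xr }
                 else { ρ with f2r := (Tok.bit b).code.reverse ++ ρ.f2r }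
  | .endl, ρ => { ρ with f2r := Tok.endl.code.reverse ++ ρ.f2r,
                         md := if ρ.md = [] then [] else [false] }
  | .endc, ρ => { ρ with f2r := Tok.endc.code.reverse ++ ρ.f2r, ls := [],
                         he := if ρ.ls = [] then [true] else ρ.he }
  | .endf, ρ => { ρ with f2r := Tok.endf.code.reverse ++ ρ.f2r }
  | .unit, ρ => ρ

/-- **The scan handler follows its specification**, within `11` steps. [folklore] -/
theorem runs_scanTok (t : Tok) (ρ : RF) (hρ : scP ρ) :
    Runs (scanTok t) (mk ρ) (mk (scS t ρ)) 11 := by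
  obtain ⟨hmd, hls, hhe⟩ := hρ
  cases t with
  | pol b =>
    have h1 := runs_emit R.f2r (.pol b) (mk ρ)
    simp only [update_mk_f2r, mk_f2r] at h1
    set ρ₁ : RF := { ρ with f2r := (Tok.pol b).code.reverse ++ ρ.f2r } with hρ₁
    have h2 : Runs (.pop .md (.push .md true) (.push .md false) (.push .md true)) (mk ρ₁)
        (mk { ρ₁ with md := if ρ.md = [false] then [false] else [true] }) 3 := by
      rcases hmd with h | h | h
      · refine (Runs.pop_nil _ _ (by simp [hρ₁, h]) ((Runs.push R.md true (mk ρ₁)).mono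
          (Nat.le_refl 1))).of_eq ?_ (by omega)
        simp [hρ₁, h]
      · refine (Runs.pop_true' _ _ (by simp [hρ₁, h]) (update_mk_md ρ₁ [])
          ((Runs.push R.md true _).mono (Nat.le_refl 1))).of_eq ?_ (by omega)
        simp [hρ₁, h]
      · refine (Runs.pop_false' _ _ (by simp [hρ₁, h]) (update_mk_md ρ₁ [])
          ((Runs.push R.md false _).mono (Nat.le_refl 1))).of_eq ?_ (by omega)
        simp [hρ₁, h]
    set ρ₂ : RF := { ρ₁ with md := if ρ.md = [false] then [false] else [true] } with hρ₂
    have h3 := runs_setFlag R.ls (mk ρ₂) (by simpa [hρ₂, hρ₁] using hls)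
    refine (h1.seq (h2.seq h3)).of_eq ?_ (by omega)
    simp [hρ₂, hρ₁, scS]
  | bit b =>
    have h1 := runs_emit R.f2r (.bit b) (mk ρ)
    simp only [update_mk_f2r, mk_f2r] at h1
    set ρ₁ : RF := { ρ with f2r := (Tok.bit b).code.reverse ++ ρ.f2r } with hρ₁
    rcases hmd with h | h | h
    · have h2 : Runs (.pop .md (.push .md true ;; .push .xr b) (.push .md false) .skip) (mk ρ₁)
          (mk ρ₁) 2 := Runs.pop_nil _ _ (by simp [hρ₁, h]) (Runs.skip _)
      refine (h1.seq h2).of_eq ?_ (by omega)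
      simp [hρ₁, scS, h]
    · have h2 : Runs (.pop .md (.push .md true ;; .push .xr b) (.push .md false) .skip) (mk ρ₁)
          (mk { ρ₁ with xr := b :: ρ₁.xr }) 4 := by
        refine (Runs.pop_true' _ _ (by simp [hρ₁, h]) (update_mk_md ρ₁ [])
          ((Runs.push R.md true _).seq (Runs.push R.xr b _))).of_eq ?_ (by omega)
        simp [hρ₁, h]
      refine (h1.seq h2).of_eq ?_ (by omega)
      simp [hρ₁, scS, h]
    · have h2 : Runs (.pop .md (.push .md true ;; .push .xr b) (.push .md false) .skip) (mk ρ₁)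
          (mk ρ₁) 3 := by
        refine (Runs.pop_false' _ _ (by simp [hρ₁, h]) (update_mk_md ρ₁ [])
          ((Runs.push R.md false _).mono (Nat.le_refl 1))).of_eq ?_ (by omega)
        simp [hρ₁, h]
      refine (h1.seq h2).of_eq ?_ (by omega)
      simp [hρ₁, scS, h]
  | endl =>
    have h1 := runs_emit R.f2r .endl (mk ρ)
    simp only [update_mk_f2r, mk_f2r] at h1
    set ρ₁ : RF := { ρ with f2r := Tok.endl.code.reverse ++ ρ.f2r } with hρ₁
    have h2 : Runs (.pop .md (.push .md false) (.push .md false) .skip) (mk ρ₁)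
        (mk { ρ₁ with md := if ρ.md = [] then [] else [false] }) 3 := by
      rcases hmd with h | h | h
      · refine (Runs.pop_nil _ _ (by simp [hρ₁, h]) ((Runs.skip _).mono (Nat.zero_le 1))).of_eq
          ?_ (by omega)
        simp [hρ₁, h]
      · refine (Runs.pop_true' _ _ (by simp [hρ₁, h]) (update_mk_md ρ₁ [])
          ((Runs.push R.md false _).mono (Nat.le_refl 1))).of_eq ?_ (by omega)
        simp [hρ₁, h]
      · refine (Runs.pop_false' _ _ (by simp [hρ₁, h]) (update_mk_md ρ₁ [])
          ((Runs.push R.md false _).mono (Nat.le_refl 1))).of_eq ?_ (by omega)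
        simp [hρ₁, h]
    refine (h1.seq h2).of_eq ?_ (by omega)
    simp [hρ₁, scS]
  | endc =>
    have h1 := runs_emit R.f2r .endc (mk ρ)
    simp only [update_mk_f2r, mk_f2r] at h1
    set ρ₁ : RF := { ρ with f2r := Tok.endc.code.reverse ++ ρ.f2r } with hρ₁
    have h2 : Runs (.pop .ls .skip .skip (setFlag .he)) (mk ρ₁)
        (mk { ρ₁ with ls := [], he := if ρ.ls = [] then [true] else ρ.he }) 5 := by
      rcases hls with h | h
      · have h3 := runs_setFlag R.he (mk ρ₁) (by simpa [hρ₁] using hhe)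
        refine (Runs.pop_nil _ _ (by simp [hρ₁, h]) h3).of_eq ?_ (by omega)
        simp [hρ₁, h]
      · refine (Runs.pop_true' _ _ (by simp [hρ₁, h]) (update_mk_ls ρ₁ [])
          ((Runs.skip _).mono (Nat.zero_le 3))).of_eq ?_ (by omega)
        simp [hρ₁, h]
    refine (h1.seq h2).of_eq ?_ (by omega)
    simp [hρ₁, scS]
  | endf =>
    have h1 := runs_emit R.f2r .endf (mk ρ)
    simp only [update_mk_f2r, mk_f2r] at h1
    exact h1.of_eq (by simp [scS]) (by omega)
  | unit => exact (Runs.skip _).of_eq (by simp [scS]) (Nat.zero_le _)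

/-- The invariant is stable under the scan handler. [folklore] -/
theorem scP_scS (t : Tok) (ρ : RF) (hρ : scP ρ) : scP (scS t ρ) := by
  obtain ⟨hmd, hls, hhe⟩ := hρ
  cases t with
  | pol b => refine ⟨?_, Or.inr rfl, by simpa [scS] using hhe⟩; by_cases h : ρ.md = [false] <;> simp [scS, h]
  | bit b => by_cases h : ρ.md = [true] <;> simp [scP, scS, h] <;> tauto
  | endl => refine ⟨?_, by simpa [scS] using hls, by simpa [scS] using hhe⟩; by_cases h : ρ.md = [] <;> simp [scS, h]
  | endc => refine ⟨by simpa [scS] using hmd, Or.inl rfl, ?_⟩; by_cases h : ρ.ls = [] <;> simp [scS, h]; tauto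
  | endf => exact ⟨by simpa [scS] using hmd, by simpa [scS] using hls, by simpa [scS] using hhe⟩
  | unit => exact ⟨hmd, hls, hhe⟩

/-- The scan handler commutes with setting the formula register. [folklore] -/
theorem scS_setF (t : Tok) (ρ : RF) (l : List Bool) : scS t (setF ρ l) = setF (scS t ρ) l := by
  cases t with
  | pol b => simp [scS, setF]
  | bit b => by_cases h : ρ.md = [true] <;> simp [scS, setF, h]
  | endl => simp [scS, setF]
  | endc => simp [scS, setF]
  | endf => simp [scS, setF]
  | unit => simp [scS, setF]

/-- The scan handler leaves the formula register alone. [folklore] -/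
theorem scS_f (t : Tok) (ρ : RF) : (scS t ρ).f = ρ.f := by
  cases t with
  | pol b => simp [scS]
  | bit b => by_cases h : ρ.md = [true] <;> simp [scS, h]
  | endl => simp [scS]
  | endc => simp [scS]
  | endf => simp [scS]
  | unit => simp [scS]

/-- **The scan loop follows its specification.** [folklore] -/
theorem runs_scanLoop (ts : List Tok) (ρ : RF) (hρ : scP ρ) (hf : ρ.f = bits ts) :
    Runs (tokLoop .f scanH) (mk ρ) (mk (setF (ts.foldl (fun ρ t => scS t ρ) ρ) []))
      (21 * ts.length + 1) := by
  have hρ' : ρ = setF ρ (bits ts) := by cases ρ; simp only [setF] at hf ⊢; rw [hf]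
  have H := runs_tokLoop_of_spec (k := .f) (H := scanH) (P := scP) (S := scS) (setk := setF)
    (cost := fun _ _ => 11) mk_setF (fun t ρ h => by simpa using runs_scanTok t ρ h) scP_scS
    (fun t ρ _ => by simpa using scS_f t ρ)
    (fun ρ l h => by simpa [scP, setF] using h) ts ρ hρ (by simpa using hf)
  have e : specFold scS setF ts ρ = setF (ts.foldl (fun ρ t => scS t ρ) ρ) [] := by
    conv_lhs => rw [hρ']
    exact specFold_eq_foldl scS_setF (fun ρ l l' => by simp [setF]) ts ρ
  rw [e] at H
  refine H.mono ?_
  have := costFold_le (S := scS) (setk := setF) (cost := fun _ _ => 11) (P := fun _ => True)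
    (fun _ => 0) 0 11 0 (fun _ _ _ => by simp) (fun _ _ _ => by simp) (fun _ _ => by simp)
    (fun _ _ _ => trivial) (fun _ _ _ => trivial) ts ρ trivial
  simpa [Nat.mul_comm] using this

/-! #### Closed form of the scan -/

/-- The pivot bits collected by the scan: the index of the first literal of the first nonempty
clause (leading empty clauses are skipped — they raise `he`, after which the pivot is not
used). [folklore] -/
def scanX : CNF (List Bool) → List Bool
  | [] => []
  | [] :: F => scanX F
  | ((w, _) :: _) :: _ => w

/-- With a pivot, `scanX` is the pivot. [folklore] -/
theorem scanX_eq_of_pivot {F : CNF (List Bool)} {x : List Bool} (h : pivot F = some x) :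
    scanX F = x := by
  match F, h with
  | ((w, b) :: c) :: F', h => simp only [pivot, Option.some.injEq] at h; simpa [scanX] using h

/-- The scan fold: the handlers' specifications applied along a token string. [folklore] -/
def scF (ts : List Tok) (ρ : RF) : RF := ts.foldl (fun ρ t => scS t ρ) ρ

/-- `scF` on the empty string. [folklore] -/
@[simp] theorem scF_nil (ρ : RF) : scF [] ρ = ρ := rfl

/-- `scF` on a cons. [folklore] -/
@[simp] theorem scF_cons (t : Tok) (ts : List Tok) (ρ : RF) : scF (t :: ts) ρ = scF ts (scS t ρ) := rfl

/-- `scF` on a concatenation. [folklore] -/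
@[simp] theorem scF_append (s t : List Tok) (ρ : RF) : scF (s ++ t) ρ = scF t (scF s ρ) := by
  simp [scF]

/-- Index bits outside the first literal are only copied. [folklore] -/
theorem scF_bits_normal (w : List Bool) (ρ : RF) (h : ρ.md = [false]) :
    scF (w.map Tok.bit) ρ = { ρ with f2r := (bits (w.map Tok.bit)).reverse ++ ρ.f2r } := by
  induction w generalizing ρ with
  | nil => rfl
  | cons b w ih =>
    rw [List.map_cons, scF_cons, ih _ (by simp [scS, h])]
    simp [scS, h]

/-- Index bits of the first literal are also collected in `xr`. [folklore] -/
theorem scF_bits_inlit (w : List Bool) (ρ : RF) (h : ρ.md = [true]) :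
    scF (w.map Tok.bit) ρ =
      { ρ with f2r := (bits (w.map Tok.bit)).reverse ++ ρ.f2r, xr := w.reverse ++ ρ.xr } := by
  induction w generalizing ρ with
  | nil => rfl
  | cons b w ih =>
    rw [List.map_cons, scF_cons, ih _ (by simp [scS, h])]
    simp [scS, h]

/-- A literal outside the first one: copied, and `ls` is raised. [folklore] -/
theorem scF_lit_normal (l : List Bool × Bool) (ρ : RF) (h : ρ.md = [false]) :
    scF (litToks l) ρ = { ρ with f2r := (bits (litToks l)).reverse ++ ρ.f2r, ls := [true] } := by
  obtain ⟨w, b⟩ := l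
  simp only [litToks, scF_append, scF_cons, scF_nil]
  rw [scF_bits_normal w _ (by simp [scS, h])]
  simp [scS, h]

/-- The literals of a clause outside the first literal. [folklore] -/
theorem scF_lits_normal (c : Clause (List Bool)) (ρ : RF) (h : ρ.md = [false]) :
    scF (c.flatMap litToks) ρ =
      { ρ with
        f2r := (bits (c.flatMap litToks)).reverse ++ ρ.f2r,
        ls := if c = [] then ρ.ls else [true] } := by
  induction c generalizing ρ with
  | nil => simp
  | cons l c ih =>
    rw [List.flatMap_cons, scF_append, scF_lit_normal l _ h, ih _ (by simp [h])]
    simp [bits]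

/-- The rest of a clause (literals, then `endc`) outside the first literal: `he` is raised iff
the clause had no literal at all. [folklore] -/
theorem scF_clauseRest_normal (c : Clause (List Bool)) (ρ : RF) (h : ρ.md = [false]) :
    scF (c.flatMap litToks ++ [Tok.endc]) ρ =
      { ρ with
        f2r := (bits (c.flatMap litToks ++ [Tok.endc])).reverse ++ ρ.f2r, ls := [],
        he := if c = [] ∧ ρ.ls = [] then [true] else ρ.he } := by
  rw [scF_append, scF_lits_normal c _ h]
  by_cases hc : c = [] <;> by_cases hl : ρ.ls = [] <;> simp [scS, hc, hl]

/-- A formula outside the first literal: copied, `he` raised iff some clause is empty. [folklore] -/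
theorem scF_formula_normal (F : CNF (List Bool)) (ρ : RF) (h : ρ.md = [false])
    (hl : ρ.ls = []) :
    scF (formulaToks F) ρ =
      { ρ with
        f2r := (bits (formulaToks F)).reverse ++ ρ.f2r,
        he := if [] ∈ F then [true] else ρ.he } := by
  induction F generalizing ρ with
  | nil => cases ρ; simp only at hl; subst hl; simp
  | cons c F ih =>
    rw [formulaToks_cons, scF_append, clauseToks, scF_clauseRest_normal c _ h, ih _ (by simp [h])
      (by simp)]
    by_cases hc : c = [] <;> simp [hc, hl, bits, eq_comm]

/-- **Closed form of the scan** (from mode `[]`, flags down): the formula is copied to `f2r`,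
the pivot bits are collected in `xr`, `he` is raised iff some clause is empty; the mode ends
`[]` or `[false]` and `ls` ends down. [folklore] -/
theorem scF_formula (F : CNF (List Bool)) (ρ : RF) (h : ρ.md = []) (hl : ρ.ls = []) :
    ∃ md', (md' = [] ∨ md' = [false]) ∧ scF (formulaToks F) ρ =
      { ρ with
        f2r := (bits (formulaToks F)).reverse ++ ρ.f2r, xr := (scanX F).reverse ++ ρ.xr,
        he := if [] ∈ F then [true] else ρ.he, md := md', ls := [] } := by
  induction F generalizing ρ with
  | nil => exact ⟨[], Or.inl rfl, by cases ρ; simp only at h hl; subst h hl; simp [scanX]⟩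
  | cons c F ih =>
    rcases c with _ | ⟨⟨w, b⟩, c⟩
    · -- an empty first clause: `he` is raised, the mode stays `[]`
      set ρ₁ : RF :=
        { ρ with f2r := (bits (clauseToks [])).reverse ++ ρ.f2r, ls := [], he := [true] } with hρ₁
      have h1 : scF (clauseToks []) ρ = ρ₁ := by
        simp [hρ₁, clauseToks, scS, hl]
      obtain ⟨md', hmd', e⟩ := ih ρ₁ (by simp [hρ₁, h]) (by simp [hρ₁])
      refine ⟨md', hmd', ?_⟩
      rw [formulaToks_cons, scF_append, h1, e]
      simp [hρ₁, scanX]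
    · -- a nonempty first clause: its first literal is the pivot
      refine ⟨[false], Or.inr rfl, ?_⟩
      have e1 : scF (litToks (w, b)) ρ =
          { ρ with
            f2r := (bits (litToks (w, b))).reverse ++ ρ.f2r, xr := w.reverse ++ ρ.xr,
            md := [false], ls := [true] } := by
        simp only [litToks, scF_append, scF_cons, scF_nil]
        rw [scF_bits_inlit w _ (by simp [scS, h])]
        simp [scS, h]
      simp only [formulaToks_cons, clauseToks, List.flatMap_cons, scF_append, scF_cons, scF_nil]
      rw [e1, scF_lits_normal c _ (by simp)]
      have e2 : ∀ ρ' : RF, ρ'.md = [false] → ρ'.ls = [true] →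
          scS Tok.endc ρ' = { ρ' with f2r := Tok.endc.code.reverse ++ ρ'.f2r, ls := [] } := by
        intro ρ' _ h2; simp [scS, h2]
      rw [e2 _ (by simp) (by by_cases hc : c = [] <;> simp [hc]),
        scF_formula_normal F _ (by simp) (by simp)]
      by_cases hc : c = [] <;> simp [scanX, bits, hc]

/-- **The scan pass.** From mode `[]` with flags down, on `f = code F`: `f` is consumed and
copied to `f2r`, the pivot bits are in `xr`, `he` tells whether `F` has an empty clause, mode
and `ls` are reset; within `21 |toks| + 8` steps. [folklore] -/
theorem runs_scan (F : CNF (List Bool)) (ρ : RF) (hmd : ρ.md = []) (hls : ρ.ls = [])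
    (hhe : ρ.he = [] ∨ ρ.he = [true]) (hf : ρ.f = bits (formulaToks F)) :
    Runs scan (mk ρ)
      (mk
        { ρ with
          f := [], f2r := (bits (formulaToks F)).reverse ++ ρ.f2r,
          xr := (scanX F).reverse ++ ρ.xr, he := if [] ∈ F then [true] else ρ.he,
          md := [], ls := [] })
      (21 * (formulaToks F).length + 8) := by
  have h1 := runs_scanLoop (formulaToks F) ρ ⟨Or.inl hmd, Or.inl hls, hhe⟩ hf
  obtain ⟨md', hmd', e⟩ := scF_formula F ρ hmd hls
  rw [scF] at e
  rw [e] at h1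
  set ρ₁ : RF :=
    { ρ with
      f2r := (bits (formulaToks F)).reverse ++ ρ.f2r, xr := (scanX F).reverse ++ ρ.xr,
      he := if [] ∈ F then [true] else ρ.he, md := md', ls := [] } with hρ₁
  have h2 := runs_clear R.md (mk (setF ρ₁ []))
  have h3 := runs_clear R.ls (Function.update (mk (setF ρ₁ [])) R.md [])
  refine (h1.seq (h2.seq h3)).of_eq ?_ ?_
  · simp [setF, hρ₁]
  · have : md'.length ≤ 1 := by rcases hmd' with rfl | rfl <;> simp
    simp [setF, hρ₁]
    omega

/-! ### Pass 3: restriction -/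

/-- Invariant of the restriction pass: scratch registers empty, flags well formed. [folklore] -/
def reP (ρ : RF) : Prop :=
  ρ.t = [] ∧ ρ.u = [] ∧ (ρ.mis = [] ∨ ρ.mis = [true]) ∧ (ρ.sat = [] ∨ ρ.sat = [true])

/-- The optional copy of the token to `f3r`. [folklore] -/
def cpS (cp : Bool) (t : Tok) (ρ : RF) : RF :=
  if cp then { ρ with f3r := t.code.reverse ++ ρ.f3r } else ρ

/-- The optional copy follows its specification, within `5` steps. [folklore] -/
theorem runs_cpEmit (cp : Bool) (t : Tok) (ρ : RF) :
    Runs (if cp then emit .f3r t else .skip) (mk ρ) (mk (cpS cp t ρ)) 5 := by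
  cases cp
  · simpa [cpS] using (Runs.skip (mk ρ)).mono (Nat.zero_le 5)
  · simpa [cpS] using runs_emit R.f3r t (mk ρ)

/-- Specification of the restriction handler after the optional copy. [folklore] -/
def reS' (v : Bool) : Tok → RF → RF
  | .pol b, ρ => { ρ with pb := [b], mis := [], xc := ρ.x, lb := (Tok.pol b).code.reverse ++ ρ.lb }
  | .bit b, ρ =>
    match ρ.xc with
    | [] => { ρ with lb := (Tok.bit b).code.reverse ++ ρ.lb, mis := [true] }
    | c :: xc' => { ρ with lb := (Tok.bit b).code.reverse ++ ρ.lb, xc := xc',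
                           mis := if c = b then ρ.mis else [true] }
  | .endl, ρ =>
    if ρ.xc = [] ∧ ρ.mis = [] then
      match ρ.pb with
      | [] => { ρ with lb := [], xc := [], mis := [] }
      | c :: r => { ρ with lb := [], xc := [], mis := [], pb := r,
                           sat := if c = v then [true] else ρ.sat }
    else { ρ with lb := [], cb := (Tok.endl.code.reverse ++ ρ.lb).reverse ++ ρ.cb, xc := [],
                  mis := [] }
  | .endc, ρ =>
    match ρ.sat with
    | [] => { ρ with o := Tok.endc.code.reverse ++ (ρ.cb.reverse ++ ρ.o), cb := [] }
    | _ :: r => { ρ with sat := r, cb := [] }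
  | .endf, ρ => ρ
  | .unit, ρ => ρ

/-- Specification of the restriction handler. [folklore] -/
def reS (v cp : Bool) (t : Tok) (ρ : RF) : RF := reS' v t (cpS cp t ρ)

/-- Cost bound of the restriction handler: affine in the sizes of the registers it clears,
copies or pours. [folklore] -/
def reCost (_ : Tok) (ρ : RF) : ℕ :=
  10 * (ρ.pb.length + ρ.mis.length + ρ.xc.length + ρ.x.length + ρ.lb.length + ρ.cb.length) + 40

/-- The optional copy does not change the registers entering the cost. [folklore] -/
theorem reCost_cpS (cp : Bool) (t t' : Tok) (ρ : RF) : reCost t' (cpS cp t ρ) = reCost t' ρ := by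
  cases cp <;> simp [cpS, reCost]

/-- The optional copy preserves the invariant. [folklore] -/
theorem reP_cpS (cp : Bool) (t : Tok) (ρ : RF) (h : reP ρ) : reP (cpS cp t ρ) := by
  cases cp <;> simpa [cpS, reP] using h

/-- **The restriction handler (after the copy) follows its specification.** [folklore] -/
theorem runs_restrictTok' (v : Bool) (t : Tok) (ρ : RF) (hρ : reP ρ) :
    Runs (match t with
      | .pol b => clear .pb ;; .push .pb b ;; clear .mis ;; clear .xc ;; copy .x .xc .t .u ;;
          emit .lb (.pol b)
      | .bit b => emit .lb (.bit b) ;;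
          .pop .xc (if b then .skip else setFlag .mis) (if b then setFlag .mis else .skip) (setFlag .mis)
      | .endl => emit .lb .endl ;;
          .pop .xc (setFlag .mis ;; clear .xc) (setFlag .mis ;; clear .xc) .skip ;;
          .pop .mis (pour .lb .cb) (pour .lb .cb)
            (clear .lb ;; .pop .pb (if v then setFlag .sat else .skip)
              (if v then .skip else setFlag .sat) .skip)
      | .endc => .pop .sat (clear .cb) (clear .cb) (pour .cb .o ;; emit .o .endc)
      | .endf => .skip
      | .unit => .skip : Com R) (mk ρ) (mk (reS' v t ρ)) (reCost t ρ - 5) := by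
  obtain ⟨ht, hu, hmis, hsat⟩ := hρ
  cases t with
  | pol b =>
    simp only
    have h1 := runs_clear R.pb (mk ρ)
    simp only [update_mk_pb, mk_pb] at h1
    set ρ₁ : RF := { ρ with pb := [] } with hρ₁
    have h2 := Runs.push R.pb b (mk ρ₁)
    simp only [update_mk_pb, mk_pb, hρ₁] at h2
    set ρ₂ : RF := { ρ with pb := [b] } with hρ₂
    have h3 := runs_clear R.mis (mk ρ₂)
    simp only [update_mk_mis, mk_mis, hρ₂] at h3
    set ρ₃ : RF := { ρ with pb := [b], mis := [] } with hρ₃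
    have h4 := runs_clear R.xc (mk ρ₃)
    simp only [update_mk_xc, mk_xc, hρ₃] at h4
    set ρ₄ : RF := { ρ with pb := [b], mis := [], xc := [] } with hρ₄
    have h5 := runs_copy (a := R.x) (b := R.xc) (t := R.t) (u := R.u) (by decide) (by decide)
      (by decide) (by decide) (by decide) (by decide) (mk ρ₄) (by simp [hρ₄, ht]) (by simp [hρ₄, hu])
    simp only [update_mk_xc, mk_xc, mk_x, hρ₄, List.append_nil] at h5
    set ρ₅ : RF := { ρ with pb := [b], mis := [], xc := ρ.x } with hρ₅
    have h6 := runs_emit R.lb (.pol b) (mk ρ₅)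
    simp only [update_mk_lb, mk_lb, hρ₅] at h6
    refine ((h1.seq (h2.seq (h3.seq (h4.seq (h5.seq h6)))))).of_eq ?_ ?_
    · simp [reS']
    · simp only [reCost]; omega
  | bit b =>
    simp only
    have h1 := runs_emit R.lb (.bit b) (mk ρ)
    simp only [update_mk_lb, mk_lb] at h1
    set ρ₁ : RF := { ρ with lb := (Tok.bit b).code.reverse ++ ρ.lb } with hρ₁
    rcases hxc : ρ.xc with _ | ⟨c, xc'⟩
    · have h2 := runs_setFlag R.mis (mk ρ₁) (by simpa [hρ₁] using hmis)
      have h3 : Runs (.pop .xc (if b then .skip else setFlag .mis) (if b then setFlag .mis else .skip)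
          (setFlag .mis)) (mk ρ₁) (mk { ρ₁ with mis := [true] }) 5 :=
        (Runs.pop_nil _ _ (by simp [hρ₁, hxc]) h2).of_eq (by simp [hρ₁]) (by omega)
      refine (h1.seq h3).of_eq ?_ ?_
      · simp [reS', hρ₁, hxc]
      · simp only [reCost]; omega
    · have hbr : ∀ c' : Bool, Runs (if c' then (if b then Com.skip else setFlag R.mis)
          else (if b then setFlag R.mis else Com.skip)) (mk { ρ₁ with xc := xc' })
          (mk { ρ₁ with xc := xc', mis := if c' = b then ρ.mis else [true] }) 3 := by
        intro c'
        have hs := runs_setFlag R.mis (mk { ρ₁ with xc := xc' }) (by simpa [hρ₁] using hmis)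
        cases c' <;> cases b
        · simpa [hρ₁] using (Runs.skip _).mono (Nat.zero_le 3)
        · simpa [hρ₁] using hs
        · simpa [hρ₁] using hs
        · simpa [hρ₁] using (Runs.skip _).mono (Nat.zero_le 3)
      have h3 : Runs (.pop .xc (if b then .skip else setFlag .mis) (if b then setFlag .mis else .skip)
          (setFlag .mis)) (mk ρ₁)
          (mk { ρ₁ with xc := xc', mis := if c = b then ρ.mis else [true] }) 5 := by
        cases c
        · exact Runs.pop_false' _ _ (by simp [hρ₁, hxc]) (update_mk_xc ρ₁ xc') (hbr false)
        · exact Runs.pop_true' _ _ (by simp [hρ₁, hxc]) (update_mk_xc ρ₁ xc') (hbr true)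
      refine (h1.seq h3).of_eq ?_ ?_
      · simp [reS', hρ₁, hxc]
      · simp only [reCost]; omega
  | endl =>
    simp only
    have h1 := runs_emit R.lb .endl (mk ρ)
    simp only [update_mk_lb, mk_lb] at h1
    set lb' := Tok.endl.code.reverse ++ ρ.lb with hlb'
    set ρ₁ : RF := { ρ with lb := lb' } with hρ₁
    set mis' := (if ρ.xc = [] then ρ.mis else [true]) with hmis'
    have hmis'f : mis' = [] ∨ mis' = [true] := by
      rw [hmis']; split_ifs; exact hmis; exact Or.inr rfl
    -- pop xc
    set ρ₂ : RF := { ρ with lb := lb', xc := [], mis := mis' } with hρ₂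
    have h2 : Runs (.pop .xc (setFlag .mis ;; clear .xc) (setFlag .mis ;; clear .xc) .skip) (mk ρ₁)
        (mk ρ₂) (2 * ρ.xc.length + 6) := by
      rcases hxc : ρ.xc with _ | ⟨c, xc'⟩
      · refine (Runs.pop_nil _ _ (by simp [hρ₁, hxc]) (Runs.skip _)).of_eq ?_ (by omega)
        simp [hρ₁, hρ₂, hmis', hxc]
      · have hbr : Runs (setFlag R.mis ;; clear R.xc) (mk { ρ₁ with xc := xc' })
            (mk ρ₂) (3 + (2 * xc'.length + 1)) := by
          have hs := runs_setFlag R.mis (mk { ρ₁ with xc := xc' }) (by simpa [hρ₁] using hmis)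
          have hc := runs_clear R.xc (Function.update (mk { ρ₁ with xc := xc' }) R.mis [true])
          refine (hs.seq hc).of_eq ?_ ?_
          · simp [hρ₁, hρ₂, hmis', hxc]
          · simp [hρ₁]
        cases c
        · refine (Runs.pop_false' _ _ (by simp [hρ₁, hxc]) (update_mk_xc ρ₁ xc') hbr).mono ?_
          simp; omega
        · refine (Runs.pop_true' _ _ (by simp [hρ₁, hxc]) (update_mk_xc ρ₁ xc') hbr).mono ?_
          simp; omega
    -- pop mis
    have h3 : Runs (.pop .mis (pour .lb .cb) (pour .lb .cb)
        (clear .lb ;; .pop .pb (if v then setFlag .sat else .skip) (if v then .skip else setFlag .sat)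
          .skip)) (mk ρ₂) (mk (reS' v .endl ρ)) (3 * lb'.length + 10) := by
      by_cases hm : ρ.xc = [] ∧ ρ.mis = []
      · -- a literal on the pivot
        have hm' : mis' = [] := by simp [hmis', hm.1, hm.2]
        have hc := runs_clear R.lb (mk ρ₂)
        simp only [update_mk_lb, mk_lb, hρ₂] at hc
        set ρ₃ : RF := { ρ with lb := [], xc := [], mis := mis' } with hρ₃
        have hpb : Runs (.pop .pb (if v then setFlag .sat else .skip) (if v then .skip else setFlag .sat)
            .skip) (mk ρ₃) (mk (reS' v .endl ρ)) 5 := by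
          have hreS : reS' v .endl ρ = (match ρ.pb with
              | [] => { ρ with lb := [], xc := [], mis := [] }
              | c :: r => { ρ with lb := [], xc := [], mis := [], pb := r,
                                   sat := if c = v then [true] else ρ.sat }) := by
            simp only [reS', if_pos hm]
          rw [hreS]
          rcases hpbv : ρ.pb with _ | ⟨c, r⟩
          · refine (Runs.pop_nil _ _ (by simp [hρ₃, hpbv]) (Runs.skip _)).of_eq ?_ (by omega)
            simp [hρ₃, hm', hpbv]
          · have hbr : ∀ c' : Bool, Runs (if c' then (if v then setFlag R.sat else Com.skip)
                else (if v then Com.skip else setFlag R.sat)) (mk { ρ₃ with pb := r })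
                (mk { ρ₃ with pb := r, sat := if c' = v then [true] else ρ.sat }) 3 := by
              intro c'
              have hs := runs_setFlag R.sat (mk { ρ₃ with pb := r }) (by simpa [hρ₃] using hsat)
              cases c' <;> cases v
              · simpa [hρ₃] using hs
              · simpa [hρ₃] using (Runs.skip _).mono (Nat.zero_le 3)
              · simpa [hρ₃] using (Runs.skip _).mono (Nat.zero_le 3)
              · simpa [hρ₃] using hs
            simp only
            cases c
            · exact (Runs.pop_false' _ _ (by simp [hρ₃, hpbv]) (update_mk_pb ρ₃ r) (hbr false)).of_eq
                (by simp [hρ₃, hm']) (by omega)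
            · exact (Runs.pop_true' _ _ (by simp [hρ₃, hpbv]) (update_mk_pb ρ₃ r) (hbr true)).of_eq
                (by simp [hρ₃, hm']) (by omega)
        refine (Runs.pop_nil _ _ (by simp [hm']) (hc.seq hpb)).of_eq rfl ?_
        simp; omega
      · -- a literal on another variable: keep it
        have hm' : mis' = [true] := by
          rcases hmis'f with h | h
          · exfalso; apply hm
            by_cases hxc : ρ.xc = []
            · exact ⟨hxc, by simpa [hmis', hxc] using h⟩
            · simp [hmis', hxc] at h
          · exact h
        have hreS : reS' v .endl ρ =
            { ρ with lb := [], cb := lb'.reverse ++ ρ.cb, xc := [], mis := [] } := by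
          simp only [reS', if_neg hm, ← hlb']
        rw [hreS]
        have hp := runs_pour (a := R.lb) (b := R.cb) (by decide) (mk { ρ₂ with mis := [] })
        have hp' : Runs (pour R.lb R.cb) (mk { ρ₂ with mis := [] })
            (mk { ρ with lb := [], cb := lb'.reverse ++ ρ.cb, xc := [], mis := [] })
            (3 * lb'.length + 1) :=
          hp.of_eq (by simp [hρ₂]) (by simp [hρ₂])
        exact (Runs.pop_true' _ _ (by simp [hρ₂, hm']) (update_mk_mis ρ₂ []) hp').mono (by omega)
    refine (h1.seq (h2.seq h3)).of_eq rfl ?_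
    simp only [reCost, hlb', List.length_append, List.length_reverse, Tok.code, List.length_cons,
      List.length_nil]
    omega
  | endc =>
    simp only
    rcases hsat with hs | hs
    · have hp := runs_pour (a := R.cb) (b := R.o) (by decide) (mk ρ)
      simp only [update_mk_cb, update_mk_o, mk_cb, mk_o] at hp
      have he := runs_emit R.o .endc (mk { ρ with cb := [], o := ρ.cb.reverse ++ ρ.o })
      simp only [update_mk_o, mk_o] at he
      refine (Runs.pop_nil _ _ (by simp [hs]) (hp.seq he)).of_eq ?_ ?_
      · simp [reS', hs]
      · simp only [reCost]; omega
    · have hc := runs_clear R.cb (mk { ρ with sat := [] })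
      simp only [update_mk_cb, mk_cb] at hc
      refine (Runs.pop_true' _ _ (by simp [hs]) (update_mk_sat ρ []) hc).of_eq ?_ ?_
      · simp [reS', hs]
      · simp only [reCost]; omega
  | endf =>
    simp only
    exact (Runs.skip _).of_eq (by simp [reS']) (Nat.zero_le _)
  | unit =>
    simp only
    exact (Runs.skip _).of_eq (by simp [reS']) (Nat.zero_le _)

/-- **The restriction handler follows its specification.** [folklore] -/
theorem runs_restrictTok (v cp : Bool) (t : Tok) (ρ : RF) (hρ : reP ρ) :
    Runs (restrictTok v cp t) (mk ρ) (mk (reS v cp t ρ)) (reCost t ρ) := by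
  have h1 := runs_cpEmit cp t ρ
  have h2 := runs_restrictTok' v t (cpS cp t ρ) (reP_cpS cp t ρ hρ)
  rw [reCost_cpS] at h2
  have h3 := h1.seq h2
  have hc : 5 + (reCost t ρ - 5) = reCost t ρ := by unfold reCost; omega
  rw [hc] at h3
  exact h3

/-! #### The restriction loop and its cost -/

/-- Setting a source register (`f2` or `f3`). [folklore] -/
def setSrc (src : R) (ρ : RF) (l : List Bool) : RF :=
  match src with
  | .f2 => { ρ with f2 := l }
  | .f3 => { ρ with f3 := l }
  | _ => ρ

/-- The invariant of the restriction pass with the pivot fixed to `x₀`. [folklore] -/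
def rePx (x₀ : List Bool) (ρ : RF) : Prop := reP ρ ∧ ρ.x = x₀

/-- The restriction handler preserves the invariant and the pivot. [folklore] -/
theorem rePx_reS (v cp : Bool) (x₀ : List Bool) (t : Tok) (ρ : RF) (h : rePx x₀ ρ) :
    rePx x₀ (reS v cp t ρ) := by
  obtain ⟨⟨ht, hu, hmis, hsat⟩, hx⟩ := h
  have key : ∀ ρ' : RF, reP ρ' → ρ'.x = x₀ → rePx x₀ (reS' v t ρ') := by
    intro ρ' ⟨ht, hu, hmis, hsat⟩ hx
    cases t with
    | pol b => exact ⟨⟨by simpa [reS'] using ht, by simpa [reS'] using hu, Or.inl (by simp [reS']),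
        by simpa [reS'] using hsat⟩, by simpa [reS'] using hx⟩
    | bit b =>
      rcases hxc : ρ'.xc with _ | ⟨c, xc'⟩
      · exact ⟨⟨by simp [reS', hxc, ht], by simp [reS', hxc, hu], Or.inr (by simp [reS', hxc]),
          by simpa [reS', hxc] using hsat⟩, by simpa [reS', hxc] using hx⟩
      · refine ⟨⟨by simp [reS', hxc, ht], by simp [reS', hxc, hu], ?_, by simpa [reS', hxc] using hsat⟩,
          by simpa [reS', hxc] using hx⟩
        by_cases hcb : c = b <;> simp [reS', hxc, hcb]; exact hmis
    | endl =>
      by_cases hm : ρ'.xc = [] ∧ ρ'.mis = []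
      · rcases hpb : ρ'.pb with _ | ⟨c, r⟩
        · simp only [rePx, reP, reS', if_pos hm, hpb]
          exact ⟨⟨ht, hu, Or.inl trivial, hsat⟩, hx⟩
        · simp only [rePx, reP, reS', if_pos hm, hpb]
          refine ⟨⟨ht, hu, Or.inl trivial, ?_⟩, hx⟩
          by_cases hcv : c = v
          · exact Or.inr (by simp [hcv])
          · simpa [hcv] using hsat
      · simp only [rePx, reP, reS', if_neg hm]
        exact ⟨⟨ht, hu, Or.inl trivial, hsat⟩, hx⟩
    | endc =>
      rcases hsat with hs | hs
      · exact ⟨⟨by simp [reS', hs, ht], by simp [reS', hs, hu], by simpa [reS', hs] using hmis,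
          Or.inl (by simp [reS', hs])⟩, by simpa [reS', hs] using hx⟩
      · exact ⟨⟨by simp [reS', hs, ht], by simp [reS', hs, hu], by simpa [reS', hs] using hmis,
          Or.inl (by simp [reS', hs])⟩, by simpa [reS', hs] using hx⟩
    | endf => exact ⟨⟨ht, hu, hmis, hsat⟩, hx⟩
    | unit => exact ⟨⟨ht, hu, hmis, hsat⟩, hx⟩
  exact key _ (reP_cpS cp t ρ ⟨ht, hu, hmis, hsat⟩) (by cases cp <;> simp [cpS, hx])

/-- The potential of the restriction pass. [folklore] -/
def reTot (ρ : RF) : ℕ :=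
  ρ.pb.length + ρ.mis.length + ρ.xc.length + ρ.x.length + ρ.lb.length + ρ.cb.length

/-- The potential grows by at most `4 + |x₀|` per token. [folklore] -/
theorem reTot_reS (v cp : Bool) (x₀ : List Bool) (t : Tok) (ρ : RF) (h : rePx x₀ ρ) :
    reTot (reS v cp t ρ) ≤ reTot ρ + (4 + x₀.length) := by
  obtain ⟨⟨-, -, hmis, hsat⟩, hx⟩ := h
  have key : ∀ ρ' : RF, (ρ'.mis = [] ∨ ρ'.mis = [true]) → ρ'.x = x₀ →
      reTot (reS' v t ρ') ≤ reTot ρ' + (4 + x₀.length) := by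
    intro ρ' hmis hx
    have hm : ρ'.mis.length ≤ 1 := by rcases hmis with h | h <;> simp [h]
    cases t with
    | pol b => simp [reS', reTot, Tok.code, ← hx]; omega
    | bit b =>
      rcases hxc : ρ'.xc with _ | ⟨c, xc'⟩
      · simp [reS', reTot, hxc, Tok.code]; omega
      · by_cases hcb : c = b <;> simp [reS', reTot, hxc, hcb, Tok.code] <;> omega
    | endl =>
      by_cases hmm : ρ'.xc = [] ∧ ρ'.mis = []
      · rcases hpb : ρ'.pb with _ | ⟨c, r⟩
        · simp only [reS', if_pos hmm, hpb, reTot]; simp; omega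
        · simp only [reS', if_pos hmm, hpb, reTot]
          by_cases hcv : c = v <;> simp [hcv] <;> omega
      · simp only [reS', if_neg hmm, reTot]; simp [Tok.code]; omega
    | endc => rcases hsat' : ρ'.sat with _ | ⟨c, r⟩ <;> simp [reS', reTot, hsat'] <;> omega
    | endf => simp [reS']
    | unit => simp [reS']
  have h1 : reTot (cpS cp t ρ) = reTot ρ := by cases cp <;> simp [cpS, reTot]
  have := key (cpS cp t ρ) (by cases cp <;> simpa [cpS] using hmis) (by cases cp <;> simp [cpS, hx])
  rw [h1] at this
  exact this

/-- The restriction handler leaves the source registers alone. [folklore] -/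
theorem reS_f2_f3 (v cp : Bool) (t : Tok) (ρ : RF) :
    (reS v cp t ρ).f2 = ρ.f2 ∧ (reS v cp t ρ).f3 = ρ.f3 := by
  have key : ∀ ρ' : RF, (reS' v t ρ').f2 = ρ'.f2 ∧ (reS' v t ρ').f3 = ρ'.f3 := by
    intro ρ'
    cases t with
    | pol b => simp [reS']
    | bit b => rcases hxc : ρ'.xc with _ | ⟨c, xc'⟩ <;> simp [reS', hxc]
    | endl =>
      by_cases hm : ρ'.xc = [] ∧ ρ'.mis = []
      · rcases hpb : ρ'.pb with _ | ⟨c, r⟩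
        · simp only [reS', if_pos hm, hpb]; simp
        · simp only [reS', if_pos hm, hpb]; simp
      · simp only [reS', if_neg hm]; simp
    | endc => rcases hs : ρ'.sat with _ | ⟨c, r⟩ <;> simp [reS', hs]
    | endf => simp [reS']
    | unit => simp [reS']
  obtain ⟨h2, h3⟩ := key (cpS cp t ρ)
  exact ⟨by rw [reS, h2]; cases cp <;> simp [cpS], by rw [reS, h3]; cases cp <;> simp [cpS]⟩

/-- The restriction handler commutes with setting the source registers. [folklore] -/
theorem reS_setSrc (v cp : Bool) (src : R) (t : Tok) (ρ : RF) (l : List Bool)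
    (hsrc : src = .f2 ∨ src = .f3) :
    reS v cp t (setSrc src ρ l) = setSrc src (reS v cp t ρ) l := by
  have key : ∀ ρ' : RF, reS' v t (setSrc src ρ' l) = setSrc src (reS' v t ρ') l := by
    intro ρ'
    rcases hsrc with rfl | rfl
    all_goals
      cases t with
      | pol b => simp [reS', setSrc]
      | bit b => rcases hxc : ρ'.xc with _ | ⟨c, xc'⟩ <;> simp [reS', setSrc, hxc]
      | endl =>
        by_cases hm : ρ'.xc = [] ∧ ρ'.mis = []
        · rcases hpb : ρ'.pb with _ | ⟨c, r⟩
          · simp only [reS', setSrc, if_pos hm, hpb]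
          · simp only [reS', setSrc, if_pos hm, hpb]
        · simp only [reS', setSrc, if_neg hm]
      | endc => rcases hs : ρ'.sat with _ | ⟨c, r⟩ <;> simp [reS', setSrc, hs]
      | endf => simp [reS', setSrc]
      | unit => simp [reS', setSrc]
  have hcp : cpS cp t (setSrc src ρ l) = setSrc src (cpS cp t ρ) l := by
    rcases hsrc with rfl | rfl <;> cases cp <;> simp [cpS, setSrc]
  rw [reS, hcp, key, reS]

/-- The restriction fold. [folklore] -/
def reF (v cp : Bool) (ts : List Tok) (ρ : RF) : RF := ts.foldl (fun ρ t => reS v cp t ρ) ρ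

/-- `reF` on the empty string. [folklore] -/
@[simp] theorem reF_nil (v cp : Bool) (ρ : RF) : reF v cp [] ρ = ρ := rfl

/-- `reF` on a cons. [folklore] -/
@[simp] theorem reF_cons (v cp : Bool) (t : Tok) (ts : List Tok) (ρ : RF) :
    reF v cp (t :: ts) ρ = reF v cp ts (reS v cp t ρ) := rfl

/-- `reF` on a concatenation. [folklore] -/
@[simp] theorem reF_append (v cp : Bool) (s t : List Tok) (ρ : RF) :
    reF v cp (s ++ t) ρ = reF v cp t (reF v cp s ρ) := by
  simp [reF]

/-- **The restriction loop follows its specification**, with a cubic cost bound. [folklore] -/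
theorem runs_restrictLoop (v cp : Bool) (src : R) (hsrc : src = .f2 ∨ src = .f3) (ts : List Tok)
    (ρ : RF) (hρ : reP ρ) (hs : mk ρ src = bits ts) :
    Runs (tokLoop src (restrictH v cp)) (mk ρ) (mk (setSrc src (reF v cp ts ρ) []))
      (ts.length * (10 * (reTot ρ + (4 + ρ.x.length) * ts.length) + 50) + 1) := by
  have hset : ∀ ρ' l, mk (setSrc src ρ' l) = Function.update (mk ρ') src l := by
    intro ρ' l; rcases hsrc with rfl | rfl <;> simp [setSrc]
  have hρ' : ρ = setSrc src ρ (bits ts) := by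
    rcases hsrc with rfl | rfl
    · cases ρ; simp only [setSrc, mk_f2] at hs ⊢; rw [hs]
    · cases ρ; simp only [setSrc, mk_f3] at hs ⊢; rw [hs]
  have H := runs_tokLoop_of_spec (k := src) (H := restrictH v cp) (P := rePx ρ.x) (S := reS v cp)
    (setk := setSrc src) (cost := reCost) hset
    (fun t ρ h => by simpa using runs_restrictTok v cp t ρ h.1) (rePx_reS v cp ρ.x)
    (fun t ρ' _ => by
      rcases hsrc with rfl | rfl
      · simpa using (reS_f2_f3 v cp t ρ').1
      · simpa using (reS_f2_f3 v cp t ρ').2)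
    (fun ρ' l h => by
      rcases hsrc with rfl | rfl <;> simpa [rePx, reP, setSrc] using h) ts ρ ⟨hρ, rfl⟩ hs
  have e : specFold (reS v cp) (setSrc src) ts ρ = setSrc src (reF v cp ts ρ) [] := by
    conv_lhs => rw [hρ']
    exact specFold_eq_foldl (fun t ρ' l => reS_setSrc v cp src t ρ' l hsrc)
      (fun ρ' l l' => by rcases hsrc with rfl | rfl <;> simp [setSrc]) ts ρ
  rw [e] at H
  refine H.mono ?_
  have := costFold_le (S := reS v cp) (setk := setSrc src) (cost := reCost) (P := rePx ρ.x) reTot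
    10 40 (4 + ρ.x.length) (fun t ρ' _ => by simp [reCost, reTot])
    (fun t ρ' h => reTot_reS v cp ρ.x t ρ' h)
    (fun ρ' l => by rcases hsrc with rfl | rfl <;> simp [setSrc, reTot]) (rePx_reS v cp ρ.x)
    (fun ρ' l h => by rcases hsrc with rfl | rfl <;> simpa [rePx, reP, setSrc] using h) ts ρ ⟨hρ, rfl⟩
  exact this

/-! #### Closed form of the restriction -/

/-- Without copying, the restriction handler is `reS'`. [folklore] -/
@[simp] theorem reS_false (v : Bool) (t : Tok) (ρ : RF) : reS v false t ρ = reS' v t ρ := by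
  simp [reS, cpS]

/-- The bitwise comparison of an index `w` against the pivot copy `xc`: the unread rest of the
copy and whether a mismatch (or exhaustion of the copy) occurred. [folklore] -/
def cmpX : List Bool → List Bool → List Bool × Bool
  | [], xc => (xc, false)
  | _ :: w, [] => ((cmpX w []).1, true)
  | b :: w, c :: xc => ((cmpX w xc).1, (cmpX w xc).2 || !(decide (c = b)))

/-- Against an exhausted copy every further bit is a mismatch, and the copy stays empty. [folklore] -/
theorem cmpX_nil (w : List Bool) : (cmpX w []).1 = [] := by
  induction w with
  | nil => rfl
  | cons b w ih => simpa [cmpX] using ih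

/-- **The comparison is exact**: no mismatch and an exhausted copy iff the index is the pivot. [folklore] -/
theorem cmpX_iff (w x : List Bool) : ((cmpX w x).1 = [] ∧ (cmpX w x).2 = false) ↔ w = x := by
  induction w generalizing x with
  | nil => simp [cmpX, eq_comm]
  | cons b w ih =>
    cases x with
    | nil => simp [cmpX]
    | cons c x =>
      simp only [cmpX, Bool.or_eq_false_iff, List.cons.injEq]
      constructor
      · rintro ⟨h1, h2, h3⟩
        have := (ih x).1 ⟨h1, h2⟩
        simp at h3
        exact ⟨h3.symm, this⟩
      · rintro ⟨rfl, rfl⟩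
        refine ⟨((ih w).2 rfl).1, ((ih w).2 rfl).2, by simp⟩

/-- Index bits under the restriction fold: buffered in `lb` and compared against `xc`. [folklore] -/
theorem reF_bits (v : Bool) (w : List Bool) (ρ : RF) :
    reF v false (w.map Tok.bit) ρ =
      { ρ with
        lb := (bits (w.map Tok.bit)).reverse ++ ρ.lb, xc := (cmpX w ρ.xc).1,
        mis := if (cmpX w ρ.xc).2 then [true] else ρ.mis } := by
  induction w generalizing ρ with
  | nil => simp [cmpX]
  | cons b w ih =>
    rw [List.map_cons, reF_cons, reS_false, ih]
    rcases hxc : ρ.xc with _ | ⟨c, xc'⟩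
    · simp [reS', hxc, cmpX]
    · by_cases hcb : c = b
      · subst hcb; simp [reS', hxc, cmpX]
      · simp [reS', hxc, cmpX, hcb]

/-- **A literal under the restriction fold** (from an empty literal buffer): a literal on the
pivot is deleted, raising `sat` if its polarity is `v`; any other literal is appended (coded)
to the clause buffer. [folklore] -/
theorem reF_lit (v : Bool) (w : List Bool) (b : Bool) (ρ : RF) (hlb : ρ.lb = []) :
    reF v false (litToks (w, b)) ρ =
      if w = ρ.x then
        { ρ with pb := [], sat := if b = v then [true] else ρ.sat, lb := [], xc := [], mis := [] }
      else { ρ with pb := [b], cb := bits (litToks (w, b)) ++ ρ.cb, lb := [], xc := [], mis := [] } := by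
  simp only [litToks, reF_append, reF_cons, reF_nil, reS_false]
  have h1 : reS' v (.pol b) ρ =
      { ρ with pb := [b], mis := [], xc := ρ.x, lb := (Tok.pol b).code.reverse ++ ρ.lb } := rfl
  rw [h1, reF_bits]
  simp only [hlb, List.append_nil]
  have key := cmpX_iff w ρ.x
  by_cases hw : w = ρ.x
  · have h2 : (cmpX w ρ.x).1 = [] ∧ (cmpX w ρ.x).2 = false := key.2 hw
    rw [if_pos hw]
    simp only [reS', h2]
    simp
  · rw [if_neg hw]
    have h2 : ¬ ((cmpX w ρ.x).1 = [] ∧ (if (cmpX w ρ.x).2 then [true] else ([] : List Bool)) = []) := by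
      intro h; apply hw; apply key.1
      refine ⟨h.1, ?_⟩
      by_contra h3
      simp at h3
      simp [h3] at h
    simp only [reS']
    rw [if_neg (by simpa using h2)]
    simp [bits]

/-- The kept literals of a clause, as the machine lists them (reverse order). [folklore] -/
def kept (x : List Bool) (c : Clause (List Bool)) : Clause (List Bool) :=
  (c.filter fun l => l.1 ≠ x).reverse

/-- **The literals of a clause under the restriction fold** (from empty buffers): `sat` is
raised iff the clause contains `(x, v)`, the clause buffer receives the kept literals. [folklore] -/
theorem reF_lits (v : Bool) (c : Clause (List Bool)) :
    ∀ ρ : RF, ρ.lb = [] → ρ.pb.length ≤ 1 →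
      ∃ p : List Bool, p.length ≤ 1 ∧ reF v false (c.flatMap litToks) ρ =
        { ρ with
          pb := p, sat := if (ρ.x, v) ∈ c then [true] else ρ.sat,
          cb := bits ((kept ρ.x c).flatMap litToks) ++ ρ.cb, lb := [],
          xc := if c = [] then ρ.xc else [], mis := if c = [] then ρ.mis else [] } := by
  induction c with
  | nil => intro ρ hlb hpb; exact ⟨ρ.pb, hpb, by cases ρ; simp only at hlb; subst hlb; simp [kept]⟩
  | cons l c ih =>
    intro ρ hlb hpb
    obtain ⟨w, b⟩ := l
    rw [List.flatMap_cons, reF_append, reF_lit v w b ρ hlb]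
    by_cases hw : w = ρ.x
    · rw [if_pos hw]
      obtain ⟨p, hp, e⟩ := ih
        { ρ with pb := [], sat := if b = v then [true] else ρ.sat, lb := [], xc := [], mis := [] }
        rfl (by simp)
      refine ⟨p, hp, ?_⟩
      rw [e]
      by_cases hbv : b = v
      · subst hbv; by_cases hc : c = [] <;> simp [kept, hc, hw]
      · by_cases hc : c = [] <;> simp [kept, hc, hbv, hw, Ne.symm hbv]
    · rw [if_neg hw]
      obtain ⟨p, hp, e⟩ := ih
        { ρ with pb := [b], cb := bits (litToks (w, b)) ++ ρ.cb, lb := [], xc := [], mis := [] }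
        rfl (by simp)
      refine ⟨p, hp, ?_⟩
      rw [e]
      have : (ρ.x, v) ≠ (w, b) := fun h => hw (Prod.ext_iff.1 h).1.symm
      by_cases hc : c = [] <;> simp [kept, hc, hw, this, bits, List.flatMap_append]

/-- **A clause under the restriction fold** (from the clause-start state): a satisfied clause
leaves no trace, another one is emitted with its kept literals. [folklore] -/
theorem reF_clause (v : Bool) (c : Clause (List Bool)) (ρ : RF) (hlb : ρ.lb = [])
    (hpb : ρ.pb.length ≤ 1) (hsat : ρ.sat = []) (hcb : ρ.cb = []) :
    ∃ p : List Bool, p.length ≤ 1 ∧ reF v false (clauseToks c) ρ =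
      { ρ with
        pb := p, lb := [], xc := if c = [] then ρ.xc else [], mis := if c = [] then ρ.mis else [],
        o := if (ρ.x, v) ∈ c then ρ.o else (bits (clauseToks (kept ρ.x c))).reverse ++ ρ.o } := by
  obtain ⟨p, hp, e⟩ := reF_lits v c ρ hlb hpb
  refine ⟨p, hp, ?_⟩
  rw [clauseToks, reF_append, e, reF_cons, reF_nil, reS_false]
  by_cases hm : (ρ.x, v) ∈ c
  · simp [reS', hm, hsat, hcb]
  · simp [reS', hm, hsat, hcb, clauseToks]

/-- Tokens of the restricted formula, clause by clause. [folklore] -/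
theorem formulaToks_restrict_cons (x : List Bool) (v : Bool) (c : Clause (List Bool))
    (F : CNF (List Bool)) :
    formulaToks (restrict (c :: F) x v) =
      (if (x, v) ∈ c then [] else clauseToks (kept x c)) ++ formulaToks (restrict F x v) := by
  by_cases h : (x, v) ∈ c <;> simp [restrict, h, kept]

/-- **A formula under the restriction fold** (from the pass-start state): the code of
`restrict F x v` is emitted to `o`. [folklore] -/
theorem reF_formula (v : Bool) (F : CNF (List Bool)) :
    ∀ ρ : RF, ρ.lb = [] → ρ.pb.length ≤ 1 → ρ.sat = [] → ρ.cb = [] → ρ.xc = [] → ρ.mis = [] →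
      ∃ p : List Bool, p.length ≤ 1 ∧ reF v false (formulaToks F) ρ =
        { ρ with pb := p, o := (bits (formulaToks (restrict F ρ.x v))).reverse ++ ρ.o } := by
  induction F with
  | nil =>
    intro ρ _ hpb _ _ _ _
    exact ⟨ρ.pb, hpb, by simp [restrict]⟩
  | cons c F ih =>
    intro ρ hlb hpb hsat hcb hxc hmis
    obtain ⟨p, hp, e⟩ := reF_clause v c ρ hlb hpb hsat hcb
    rw [formulaToks_cons, reF_append, e]
    obtain ⟨p', hp', e'⟩ := ih
      { ρ with
        pb := p, lb := [], xc := if c = [] then ρ.xc else [],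
        mis := if c = [] then ρ.mis else [],
        o := if (ρ.x, v) ∈ c then ρ.o else (bits (clauseToks (kept ρ.x c))).reverse ++ ρ.o }
      rfl hp (by simp [hsat]) (by simp [hcb]) (by simp [hxc]) (by simp [hmis])
    refine ⟨p', hp', ?_⟩
    rw [e', formulaToks_restrict_cons]
    by_cases hm : (ρ.x, v) ∈ c <;> simp [hm, hxc, hmis, hlb]

/-- The restriction handler (without copy) does not read `f3r`. [folklore] -/
theorem reS'_setF3r (v : Bool) (t : Tok) (ρ : RF) (l : List Bool) :
    reS' v t { ρ with f3r := l } = { reS' v t ρ with f3r := l } := by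
  cases t with
  | pol b => simp [reS']
  | bit b => rcases hxc : ρ.xc with _ | ⟨c, xc'⟩ <;> simp [reS', hxc]
  | endl =>
    by_cases hm : ρ.xc = [] ∧ ρ.mis = []
    · rcases hpb : ρ.pb with _ | ⟨c, r⟩
      · simp only [reS', if_pos hm, hpb]
      · simp only [reS', if_pos hm, hpb]
    · simp only [reS', if_neg hm]
  | endc => rcases hs : ρ.sat with _ | ⟨c, r⟩ <;> simp [reS', hs]
  | endf => simp [reS']
  | unit => simp [reS']

/-- Without copying, the restriction fold does not read `f3r`. [folklore] -/
theorem reF_false_setF3r (v : Bool) (ts : List Tok) (ρ : RF) (l : List Bool) :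
    reF v false ts { ρ with f3r := l } = { reF v false ts ρ with f3r := l } := by
  induction ts generalizing ρ l with
  | nil => rfl
  | cons t ts ih => rw [reF_cons, reF_cons, reS_false, reS_false, reS'_setF3r, ih]

/-- The copy to `f3r` is the only effect of `cp`. [folklore] -/
theorem reF_true (v : Bool) (ts : List Tok) (ρ : RF) :
    reF v true ts ρ = { reF v false ts ρ with f3r := (bits ts).reverse ++ ρ.f3r } := by
  induction ts generalizing ρ with
  | nil => cases ρ; simp
  | cons t ts ih =>
    have h1 : reS v true t ρ = reS' v t { ρ with f3r := t.code.reverse ++ ρ.f3r } := by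
      simp [reS, cpS]
    rw [reF_cons, h1, ih, reS'_setF3r, reF_false_setF3r, reF_cons, reS_false]
    simp

/-- Without copying, `f3r` is unchanged. [folklore] -/
theorem reF_false_f3r (v : Bool) (ts : List Tok) (ρ : RF) : (reF v false ts ρ).f3r = ρ.f3r := by
  have key : ∀ (t : Tok) (ρ' : RF), (reS' v t ρ').f3r = ρ'.f3r := by
    intro t ρ'
    cases t with
    | pol b => simp [reS']
    | bit b => rcases hxc : ρ'.xc with _ | ⟨c, xc'⟩ <;> simp [reS', hxc]
    | endl =>
      by_cases hm : ρ'.xc = [] ∧ ρ'.mis = []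
      · rcases hpb : ρ'.pb with _ | ⟨c, r⟩
        · simp only [reS', if_pos hm, hpb]
        · simp only [reS', if_pos hm, hpb]
      · simp only [reS', if_neg hm]
    | endc => rcases hs : ρ'.sat with _ | ⟨c, r⟩ <;> simp [reS', hs]
    | endf => simp [reS']
    | unit => simp [reS']
  induction ts generalizing ρ with
  | nil => rfl
  | cons t ts ih => rw [reF_cons, ih, reS_false, key]

/-- **The restriction pass.** From the pass-start state (buffers and flags empty, pivot in `x`)
on `src = code F`: the source is consumed (and copied to `f3r` if `cp`), the code of
`restrict F x v` is prepended in reverse to `o`, and `pb`, `xc`, `mis` are reset; within a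
cubic number of steps. [Davis–Logemann–Loveland 1962, splitting rule] [folklore] -/
theorem runs_restrictPass (v cp : Bool) (src : R) (hsrc : src = .f2 ∨ src = .f3)
    (F : CNF (List Bool)) (ρ : RF) (ht : ρ.t = []) (hu : ρ.u = []) (hlb : ρ.lb = [])
    (hpb : ρ.pb = []) (hsat : ρ.sat = []) (hcb : ρ.cb = []) (hxc : ρ.xc = []) (hmis : ρ.mis = [])
    (hs : mk ρ src = bits (formulaToks F)) :
    Runs (restrictPass v cp src) (mk ρ)
      (mk (setSrc src
        { ρ with
          o := (bits (formulaToks (restrict F ρ.x v))).reverse ++ ρ.o,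
          f3r := if cp then (bits (formulaToks F)).reverse ++ ρ.f3r else ρ.f3r } []))
      ((formulaToks F).length * (10 * (ρ.x.length + (4 + ρ.x.length) * (formulaToks F).length)
        + 50) + 10) := by
  have h1 := runs_restrictLoop v cp src hsrc (formulaToks F) ρ
    ⟨ht, hu, Or.inl hmis, Or.inl hsat⟩ hs
  have htot : reTot ρ = ρ.x.length := by simp [reTot, hpb, hmis, hxc, hlb, hcb]
  rw [htot] at h1
  obtain ⟨p, hp, e⟩ := reF_formula v F ρ hlb (by simp [hpb]) hsat hcb hxc hmis
  have e' : reF v cp (formulaToks F) ρ =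
      { ρ with
        pb := p, o := (bits (formulaToks (restrict F ρ.x v))).reverse ++ ρ.o,
        f3r := if cp then (bits (formulaToks F)).reverse ++ ρ.f3r else ρ.f3r } := by
    cases cp
    · rw [e]; simp
    · rw [reF_true, e]; simp
  rw [e'] at h1
  set ρ₁ : RF :=
    { ρ with
      pb := p, o := (bits (formulaToks (restrict F ρ.x v))).reverse ++ ρ.o,
      f3r := if cp then (bits (formulaToks F)).reverse ++ ρ.f3r else ρ.f3r } with hρ₁
  have hset : ∀ l, mk (setSrc src ρ₁ l) = Function.update (mk ρ₁) src l := by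
    intro l; rcases hsrc with rfl | rfl <;> simp [setSrc]
  rw [hset] at h1
  have h2 := runs_clear R.pb (Function.update (mk ρ₁) src [])
  have h3 := runs_clear R.xc (Function.update (Function.update (mk ρ₁) src []) R.pb [])
  have h4 := runs_clear R.mis (Function.update (Function.update (Function.update (mk ρ₁) src [])
    R.pb []) R.xc [])
  refine (h1.seq (h2.seq (h3.seq h4))).of_eq ?_ ?_
  · rcases hsrc with rfl | rfl <;> simp [hρ₁, setSrc, hxc, hmis, hpb]
  · rcases hsrc with rfl | rfl
    · simp [hρ₁, hxc, hmis]; omega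
    · simp [hρ₁, hxc, hmis]; omega


/-! ### The prelude: header pass -/

/-- Invariant of the header pass: the mode is a flag. [folklore] -/
def hdP (ρ : RF) : Prop := ρ.md = [] ∨ ρ.md = [true]

/-- The capacity units contributed by a token: `N` per literal start. [folklore] -/
def capOf (N : ℕ) : Tok → List Bool
  | .pol _ => List.replicate N true
  | _ => []

/-- Specification of the header handler. [folklore] -/
def hdS (N : ℕ) (t : Tok) (ρ : RF) : RF :=
  if ρ.md = [true] then { ρ with fr := t.code.reverse ++ ρ.fr, cc := capOf N t ++ ρ.cc }
  else match t with
    | .bit b => { ρ with hd := b :: ρ.hd }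
    | .endl => { ρ with md := [true] }
    | _ => ρ

/-- **The header handler follows its specification**, within `N + 8` steps. [folklore] -/
theorem runs_hdrTok (N : ℕ) (t : Tok) (ρ : RF) (hρ : hdP ρ) :
    Runs (hdrTok N t) (mk ρ) (mk (hdS N t ρ)) (N + 8) := by
  rcases hρ with h | h
  · -- in the header
    have hk : mk ρ R.md = [] := by simp [h]
    cases t with
    | bit b => exact (Runs.pop_nil _ _ hk (Runs.push R.hd b (mk ρ))).of_eq (by simp [hdS, h]) (by omega)
    | endl => exact (Runs.pop_nil _ _ hk (Runs.push R.md true (mk ρ))).of_eq (by simp [hdS, h]) (by omega)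
    | pol b => exact (Runs.pop_nil _ _ hk (Runs.skip _)).of_eq (by simp [hdS, h]) (by omega)
    | endc => exact (Runs.pop_nil _ _ hk (Runs.skip _)).of_eq (by simp [hdS, h]) (by omega)
    | endf => exact (Runs.pop_nil _ _ hk (Runs.skip _)).of_eq (by simp [hdS, h]) (by omega)
    | unit => exact (Runs.pop_nil _ _ hk (Runs.skip _)).of_eq (by simp [hdS, h]) (by omega)
  · -- after it
    have hk : mk ρ R.md = true :: [] := by simp [h]
    have hR := update_mk_md ρ []
    cases t with
    | pol b =>
      refine (Runs.pop_true' _ _ hk hR ((Runs.push R.md true _).seq ((runs_emit R.fr (.pol b) _).seq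
        (GenProg.runs_pushes R.cc (List.replicate N true) _)))).of_eq ?_ ?_
      · simp [hdS, h, capOf]
      · simp only [List.length_replicate]; omega
    | bit b =>
      refine (Runs.pop_true' _ _ hk hR ((Runs.push R.md true _).seq ((runs_emit R.fr (.bit b) _).seq
        (Runs.skip _)))).of_eq ?_ (by omega)
      simp [hdS, h, capOf]
    | endl =>
      refine (Runs.pop_true' _ _ hk hR ((Runs.push R.md true _).seq ((runs_emit R.fr .endl _).seq
        (Runs.skip _)))).of_eq ?_ (by omega)
      simp [hdS, h, capOf]
    | endc =>
      refine (Runs.pop_true' _ _ hk hR ((Runs.push R.md true _).seq ((runs_emit R.fr .endc _).seq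
        (Runs.skip _)))).of_eq ?_ (by omega)
      simp [hdS, h, capOf]
    | endf =>
      refine (Runs.pop_true' _ _ hk hR ((Runs.push R.md true _).seq ((runs_emit R.fr .endf _).seq
        (Runs.skip _)))).of_eq ?_ (by omega)
      simp [hdS, h, capOf]
    | unit =>
      refine (Runs.pop_true' _ _ hk hR ((Runs.push R.md true _).seq ((runs_emit R.fr .unit _).seq
        (Runs.skip _)))).of_eq ?_ (by omega)
      simp [hdS, h, capOf]

/-- The invariant is stable under the header handler. [folklore] -/
theorem hdP_hdS (N : ℕ) (t : Tok) (ρ : RF) (hρ : hdP ρ) : hdP (hdS N t ρ) := by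
  rcases hρ with h | h
  · cases t <;> simp [hdP, hdS, h]
  · right; simp [hdS, h]

/-- The header handler commutes with setting the worklist register. [folklore] -/
theorem hdS_setW (N : ℕ) (t : Tok) (ρ : RF) (l : List Bool) : hdS N t (setW ρ l) = setW (hdS N t ρ) l := by
  by_cases h : ρ.md = [true]
  · simp [hdS, setW, h]
  · cases t <;> simp [hdS, setW, h]

/-- The header handler leaves the worklist register alone. [folklore] -/
theorem hdS_w (N : ℕ) (t : Tok) (ρ : RF) : (hdS N t ρ).w = ρ.w := by
  by_cases h : ρ.md = [true]
  · simp [hdS, h]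
  · cases t <;> simp [hdS, h]

/-- The header fold. [folklore] -/
def hdF (N : ℕ) (ts : List Tok) (ρ : RF) : RF := ts.foldl (fun ρ t => hdS N t ρ) ρ

/-- `hdF` on the empty string. [folklore] -/
@[simp] theorem hdF_nil (N : ℕ) (ρ : RF) : hdF N [] ρ = ρ := rfl

/-- `hdF` on a cons. [folklore] -/
@[simp] theorem hdF_cons (N : ℕ) (t : Tok) (ts : List Tok) (ρ : RF) :
    hdF N (t :: ts) ρ = hdF N ts (hdS N t ρ) := rfl

/-- `hdF` on a concatenation. [folklore] -/
@[simp] theorem hdF_append (N : ℕ) (s t : List Tok) (ρ : RF) :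
    hdF N (s ++ t) ρ = hdF N t (hdF N s ρ) := by
  simp [hdF]

/-- **The header loop follows its specification.** [folklore] -/
theorem runs_hdrLoop (N : ℕ) (ts : List Tok) (ρ : RF) (hρ : hdP ρ) (hw : ρ.w = bits ts) :
    Runs (tokLoop .w (hdrH N)) (mk ρ) (mk (setW (hdF N ts ρ) [])) ((N + 18) * ts.length + 1) := by
  have hρ' : ρ = setW ρ (bits ts) := by cases ρ; simp only [setW] at hw ⊢; rw [hw]
  have H := runs_tokLoop_of_spec (k := .w) (H := hdrH N) (P := hdP) (S := hdS N) (setk := setW)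
    (cost := fun _ _ => N + 8) mk_setW (fun t ρ h => by simpa using runs_hdrTok N t ρ h) (hdP_hdS N)
    (fun t ρ _ => by simpa using hdS_w N t ρ) (fun ρ l h => by simpa [hdP, setW] using h) ts ρ hρ
    (by simpa using hw)
  have e : specFold (hdS N) setW ts ρ = setW (hdF N ts ρ) [] := by
    conv_lhs => rw [hρ']
    exact specFold_eq_foldl (hdS_setW N) (fun ρ l l' => by simp [setW]) ts ρ
  rw [e] at H
  refine H.mono ?_
  have := costFold_le (S := hdS N) (setk := setW) (cost := fun _ _ => N + 8) (P := fun _ => True)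
    (fun _ => 0) 0 (N + 8) 0 (fun _ _ _ => by simp) (fun _ _ _ => by simp) (fun _ _ => by simp)
    (fun _ _ _ => trivial) (fun _ _ _ => trivial) ts ρ trivial
  simp only [zero_mul, zero_add, mul_zero, add_zero] at this
  rw [Nat.mul_comm] at this
  have : ts.length * (N + 8 + 10) = (N + 18) * ts.length := by ring
  omega

/-- **Closed form of the header pass on the header**: the bits are stacked (most significant
on top), the mode switches. [folklore] -/
theorem hdF_hdrToks (N n : ℕ) (ρ : RF) (h : ρ.md = []) :
    hdF N (hdrToks n) ρ = { ρ with hd := (encodeNat n).reverse ++ ρ.hd, md := [true] } := by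
  have key : ∀ (bs : List Bool) (ρ : RF), ρ.md = [] →
      hdF N (bs.map Tok.bit) ρ = { ρ with hd := bs.reverse ++ ρ.hd } := by
    intro bs
    induction bs with
    | nil => intro ρ _; rfl
    | cons b bs ih =>
      intro ρ h
      rw [List.map_cons, hdF_cons, ih _ (by simp [hdS, h])]
      simp [hdS, h]
  rw [hdrToks, hdF_append, key _ _ h]
  simp [hdS, h]

/-- `CNF.size` (the number of literal occurrences, `CNF.lean`) of a cons. [folklore] -/
@[simp] theorem _root_.Literature.Computability.Complexity.CNF.size_cons {ν : Type} (c : Clause ν) (F : CNF ν) :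
    CNF.size (c :: F) = c.length + CNF.size F := by
  simp [CNF.size]

/-- `CNF.size` of the empty clause list. [folklore] -/
@[simp] theorem _root_.Literature.Computability.Complexity.CNF.size_nil {ν : Type} : CNF.size ([] : CNF ν) = 0 := rfl

/-- The number of variables is at most the number of literal occurrences. [folklore] -/
theorem card_vars_le_size (F : CNF (List Bool)) : (CNF.vars F).card ≤ CNF.size F := by
  unfold CNF.vars CNF.size
  refine (List.toFinset_card_le _).trans ?_
  rw [List.length_map, List.length_flatten]

/-- **Closed form of the header pass after the header**: the formula is copied to `fr` and every
literal adds `N` capacity units. [folklore] -/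
theorem hdF_formulaToks (N : ℕ) (F : CNF (List Bool)) (ρ : RF) (h : ρ.md = [true]) :
    hdF N (formulaToks F) ρ =
      { ρ with
        fr := (bits (formulaToks F)).reverse ++ ρ.fr,
        cc := List.replicate (N * CNF.size F) true ++ ρ.cc } := by
  -- generic: after the header every token is copied, `pol` tokens add capacity
  have hbits : ∀ (w : List Bool) (ρ₁ : RF), ρ₁.md = [true] →
      hdF N (w.map Tok.bit) ρ₁ = { ρ₁ with fr := (bits (w.map Tok.bit)).reverse ++ ρ₁.fr } := by
    intro w
    induction w with
    | nil => intro ρ₁ _; rfl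
    | cons b w ih =>
      intro ρ₁ h₁
      rw [List.map_cons, hdF_cons, ih _ (by simp [hdS, h₁])]
      simp [hdS, h₁, capOf]
  have hlit : ∀ (l : List Bool × Bool) (ρ₁ : RF), ρ₁.md = [true] →
      hdF N (litToks l) ρ₁ =
        { ρ₁ with fr := (bits (litToks l)).reverse ++ ρ₁.fr, cc := List.replicate N true ++ ρ₁.cc } := by
    intro l ρ₁ h₁
    obtain ⟨w, b⟩ := l
    simp only [litToks, hdF_append, hdF_cons, hdF_nil]
    have e1 : hdS N (Tok.pol b) ρ₁ =
        { ρ₁ with fr := (Tok.pol b).code.reverse ++ ρ₁.fr, cc := List.replicate N true ++ ρ₁.cc } := by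
      simp [hdS, h₁, capOf]
    rw [e1, hbits w]
    · simp [hdS, h₁, capOf]
    · simp [h₁]
  have rep2 : ∀ (a b : ℕ) (l : List Bool),
      List.replicate a true ++ (List.replicate b true ++ l) = List.replicate (a + b) true ++ l := by
    intro a b l; rw [← List.append_assoc, List.replicate_append_replicate]
  have hcl : ∀ (c : Clause (List Bool)) (ρ₁ : RF), ρ₁.md = [true] →
      hdF N (clauseToks c) ρ₁ =
        { ρ₁ with
          fr := (bits (clauseToks c)).reverse ++ ρ₁.fr,
          cc := List.replicate (N * c.length) true ++ ρ₁.cc } := by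
    intro c
    induction c with
    | nil => intro ρ₁ h₁; simp [clauseToks, hdS, h₁, capOf]
    | cons l c ih =>
      intro ρ₁ h₁
      have e : clauseToks (l :: c) = litToks l ++ clauseToks c := by simp [clauseToks]
      rw [e, hdF_append, hlit l _ h₁, ih]
      · simp [bits_append, rep2, Nat.mul_succ, Nat.add_comm]
      · simp [h₁]
  induction F generalizing ρ with
  | nil => cases ρ; simp only at h; subst h; simp
  | cons c F ih =>
    rw [formulaToks_cons, hdF_append, hcl c _ h, ih]
    · simp [bits_append, rep2, Nat.mul_add, Nat.add_comm]
    · simp [h]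

/-! ### The prelude: saturating doubling -/

/-- **The unit loop of the doubling**: `m` units from `tt` go to `uu`, each taking one more unit
from the capacity `cc` while it lasts. [folklore] -/
theorem runs_dstepLoop (m : ℕ) : ∀ (u c : ℕ) (ρ : RF), ρ.tt = List.replicate m true →
    ρ.uu = List.replicate u true → ρ.cc = List.replicate c true →
    Runs (.loop .tt dstep dstep) (mk ρ)
      (mk
        { ρ with
          tt := [], uu := List.replicate (u + m + min m c) true,
          cc := List.replicate (c - min m c) true }) (6 * m + 1) := by
  induction m with
  | zero =>
    intro u c ρ ht hu hc
    refine (Runs.loop_nil _ _ (by simp [ht])).of_eq ?_ (by omega)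
    cases ρ; simp only at ht hu hc; subst ht hu hc; simp
  | succ m ih =>
    intro u c ρ ht hu hc
    -- one unit
    have hbody : ∀ c' : ℕ, ∀ ρ' : RF, ρ'.uu = List.replicate u true → ρ'.cc = List.replicate c' true →
        Runs dstep (mk ρ')
          (mk
            { ρ' with
              uu := List.replicate (u + 1 + min 1 c') true,
              cc := List.replicate (c' - min 1 c') true }) 4 := by
      intro c' ρ' hu' hc'
      have h1 := Runs.push R.uu true (mk ρ')
      simp only [update_mk_uu, mk_uu] at h1
      rcases c' with _ | c'
      · refine (h1.seq (Runs.pop_nil _ _ (by simp [hc']) (Runs.skip _))).of_eq ?_ (by omega)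
        simp [hu', hc', List.replicate_succ]
      · have h2 := Runs.push R.uu true (mk { ρ' with uu := true :: ρ'.uu, cc := List.replicate c' true })
        simp only [update_mk_uu, mk_uu] at h2
        refine (h1.seq (Runs.pop_true' _ _ (by simp [hc', List.replicate_succ]) (update_mk_cc _ _) h2)).of_eq
          ?_ (by omega)
        simp [hu', List.replicate_succ]
    have hR : Function.update (mk ρ) R.tt (List.replicate m true) = mk { ρ with tt := List.replicate m true } := by
      simp
    have h1 := hbody c { ρ with tt := List.replicate m true } (by simp [hu]) (by simp [hc])
    have h2 := ih (u + 1 + min 1 c) (c - min 1 c)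
      { ρ with
        tt := List.replicate m true, uu := List.replicate (u + 1 + min 1 c) true,
        cc := List.replicate (c - min 1 c) true } rfl rfl rfl
    refine (Runs.loop_true' (by simp [ht, List.replicate_succ]) hR h1 h2).of_eq ?_ (by omega)
    have e1 : u + 1 + min 1 c + m + min m (c - min 1 c) = u + (m + 1) + min (m + 1) c := by omega
    have e2 : c - min 1 c - min m (c - min 1 c) = c - min (m + 1) c := by omega
    simp only [e1, e2]

/-- The saturating doubling step `u ↦ min(2u + b, S)`. [folklore] -/
def dval (b : Bool) (u S : ℕ) : ℕ := min (2 * u + b.toNat) S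

/-- **The body of the doubling loop** realises `u := min(2u + b, S)` on the unary accumulator
with capacity `S - u`, within `9 S + 5` steps. [folklore] -/
theorem runs_dblBody (b : Bool) (u S : ℕ) (hu : u ≤ S) (ρ : RF) (htt : ρ.tt = [])
    (huu : ρ.uu = List.replicate u true) (hcc : ρ.cc = List.replicate (S - u) true) :
    Runs (dblBody b) (mk ρ)
      (mk
        { ρ with
          uu := List.replicate (dval b u S) true,
          cc := List.replicate (S - dval b u S) true }) (9 * S + 5) := by
  -- pour uu tt
  have h1 : Runs (pour R.uu R.tt) (mk ρ) (mk { ρ with uu := [], tt := List.replicate u true }) (3 * u + 1) :=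
    (runs_pour (a := R.uu) (b := R.tt) (by decide) (mk ρ)).of_eq (by simp [huu, htt]) (by simp [huu])
  -- the unit loop
  have h2 := runs_dstepLoop u 0 (S - u) { ρ with uu := [], tt := List.replicate u true } rfl rfl (by simp [hcc])
  simp only [zero_add] at h2
  -- the extra unit
  have eu : u + min u (S - u) = min (2 * u) S := by omega
  have ec : S - u - min u (S - u) = S - min (2 * u) S := by omega
  rw [eu, ec] at h2
  set ρ₂ : RF :=
    { ρ with
      tt := [], uu := List.replicate (min (2 * u) S) true,
      cc := List.replicate (S - min (2 * u) S) true } with hρ₂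
  have h3 : Runs (if b then addOne else .skip) (mk ρ₂)
      (mk
        { ρ with
          uu := List.replicate (dval b u S) true, cc := List.replicate (S - dval b u S) true }) 3 := by
    cases b
    · refine (Runs.skip _).of_eq ?_ (Nat.zero_le _)
      simp [hρ₂, dval, htt]
    · simp only [↓reduceIte, addOne]
      rcases hk : S - min (2 * u) S with _ | k
      · refine (Runs.pop_nil _ _ (by simp [hρ₂, hk]) (Runs.skip _)).of_eq ?_ (by omega)
        have e1 : dval true u S = min (2 * u) S := by simp only [dval, Bool.toNat_true]; omega
        simp [hρ₂, e1, hk, htt]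
      · have hp := Runs.push R.uu true (mk { ρ₂ with cc := List.replicate k true })
        refine (Runs.pop_true' _ _ (by simp [hρ₂, hk, List.replicate_succ]) (update_mk_cc ρ₂ _) hp).of_eq
          ?_ (by omega)
        have e1 : dval true u S = min (2 * u) S + 1 := by simp only [dval, Bool.toNat_true]; omega
        have e2 : S - (min (2 * u) S + 1) = k := by omega
        simp [hρ₂, e1, e2, htt, List.replicate_succ]
  refine (h1.seq (h2.seq h3)).of_eq rfl ?_
  omega

/-- The saturating fold of the doubling loop. [folklore] -/
def satFold (S : ℕ) (m : List Bool) (u : ℕ) : ℕ := m.foldl (fun u b => dval b u S) u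

/-- The (unsaturated) most-significant-bit-first value fold. [folklore] -/
def msbFold (m : List Bool) (u : ℕ) : ℕ := m.foldl (fun u b => 2 * u + b.toNat) u

/-- The value fold on a cons. [folklore] -/
theorem msbFold_cons (b : Bool) (m : List Bool) (u : ℕ) :
    msbFold (b :: m) u = msbFold m (2 * u + b.toNat) := rfl

/-- The saturating fold on a cons. [folklore] -/
theorem satFold_cons (S : ℕ) (b : Bool) (m : List Bool) (u : ℕ) :
    satFold S (b :: m) u = satFold S m (dval b u S) := rfl

/-- The value fold grows. [folklore] -/
theorem le_msbFold (m : List Bool) : ∀ u, u ≤ msbFold m u := by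
  induction m with
  | nil => intro u; exact le_rfl
  | cons b m ih => intro u; rw [msbFold_cons]; exact le_trans (by omega) (ih _)

/-- The value fold is monotone. [folklore] -/
theorem msbFold_mono (m : List Bool) : ∀ {u v}, u ≤ v → msbFold m u ≤ msbFold m v := by
  induction m with
  | nil => intro u v h; exact h
  | cons b m ih => intro u v h; rw [msbFold_cons, msbFold_cons]; exact ih (by omega)

/-- **Saturation commutes with the fold**: `satFold S m u = min (msbFold m u) S` for `u ≤ S`. [folklore] -/
theorem satFold_eq (S : ℕ) (m : List Bool) : ∀ u, u ≤ S → satFold S m u = min (msbFold m u) S := by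
  induction m with
  | nil => intro u hu; simp [satFold, msbFold, Nat.min_eq_left hu]
  | cons b m ih =>
    intro u hu
    rw [satFold_cons, msbFold_cons, dval, ih _ (Nat.min_le_right _ _)]
    by_cases h : 2 * u + b.toNat ≤ S
    · rw [Nat.min_eq_left h]
    · have hS : min (2 * u + b.toNat) S = S := Nat.min_eq_right (by omega)
      rw [hS]
      have h1 := le_msbFold m S
      have h2 := le_msbFold m (2 * u + b.toNat)
      rw [Nat.min_eq_right h1]
      exact (Nat.min_eq_right (le_trans (by omega) h2)).symm

/-- The value fold of the reversed `encodeNat` is the number. [folklore] -/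
theorem msbFold_reverse_encodeNat (n : ℕ) : msbFold (encodeNat n).reverse 0 = n := by
  have key : ∀ l : List Bool, msbFold l.reverse 0 = bitsToNat l := by
    intro l
    rw [msbFold, List.foldl_reverse]
    induction l with
    | nil => rfl
    | cons b l ih => simp only [List.foldr_cons, ih, bitsToNat_cons]; cases b <;> simp [Nat.add_comm]
  rw [key, bitsToNat_encodeNat]

/-- **The doubling loop**: the header bits (most significant first) drive `u := min(2u + b, S)`;
within `|m| (9 S + 7) + 1` steps. [folklore] -/
theorem runs_dblLoop (S : ℕ) (m : List Bool) : ∀ (u : ℕ) (ρ : RF), u ≤ S → ρ.hd = m → ρ.tt = [] →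
    ρ.uu = List.replicate u true → ρ.cc = List.replicate (S - u) true →
    Runs (.loop .hd (dblBody true) (dblBody false)) (mk ρ)
      (mk
        { ρ with
          hd := [], uu := List.replicate (satFold S m u) true,
          cc := List.replicate (S - satFold S m u) true }) (m.length * (9 * S + 7) + 1) := by
  induction m with
  | nil =>
    intro u ρ _ hh ht huu hcc
    refine (Runs.loop_nil _ _ (by simp [hh])).of_eq ?_ (by simp)
    cases ρ; simp only at hh ht huu hcc; subst hh huu hcc; simp [satFold]
  | cons b m ih =>
    intro u ρ hu hh ht huu hcc
    have hR : Function.update (mk ρ) R.hd m = mk { ρ with hd := m } := by simp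
    have h1 := runs_dblBody b u S hu { ρ with hd := m } (by simp [ht]) (by simp [huu]) (by simp [hcc])
    have hd1 : dval b u S ≤ S := Nat.min_le_right _ _
    have h2 := ih (dval b u S)
      { ρ with
        hd := m, uu := List.replicate (dval b u S) true,
        cc := List.replicate (S - dval b u S) true } hd1 rfl (by simp [ht]) rfl rfl
    have e : satFold S (b :: m) u = satFold S m (dval b u S) := rfl
    cases b
    · refine (Runs.loop_false' (by simp [hh]) hR h1 h2).of_eq (by simp [e]) ?_
      simp only [List.length_cons]; ring_nf; omega
    · refine (Runs.loop_true' (by simp [hh]) hR h1 h2).of_eq (by simp [e]) ?_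
      simp only [List.length_cons]; ring_nf; omega

/-! ### The prelude: grouping by `N` -/

/-- `popK j` when enough units remain: `j` pops, then `d`. [folklore] -/
theorem runs_popK_ge {d s : Com R} {j r : ℕ} (hjr : j ≤ r) {ρ : RF} (hρ : ρ.uu = List.replicate r true)
    {R' : Regs R} {B : ℕ} (hd : Runs d (mk { ρ with uu := List.replicate (r - j) true }) R' B) :
    Runs (popK j d s) (mk ρ) R' (B + 2 * j) := by
  induction j generalizing r ρ with
  | zero => simpa [popK, ← hρ] using hd
  | succ j ih =>
    obtain ⟨r, rfl⟩ : ∃ r', r = r' + 1 := ⟨r - 1, by omega⟩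
    rw [popK]
    have h := ih (r := r) (by omega) (ρ := { ρ with uu := List.replicate r true }) rfl
      (by simpa using hd)
    exact (Runs.pop_true' _ _ (by simp [hρ, List.replicate_succ]) (update_mk_uu ρ _) h).of_eq rfl (by omega)

/-- `popK j` when the units run short: they are all popped, then `s`. [folklore] -/
theorem runs_popK_lt {d s : Com R} {j r : ℕ} (hjr : r < j) {ρ : RF} (hρ : ρ.uu = List.replicate r true)
    {R' : Regs R} {B : ℕ} (hs : Runs s (mk { ρ with uu := [] }) R' B) :
    Runs (popK j d s) (mk ρ) R' (B + 2 * r + 2) := by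
  induction j generalizing r ρ with
  | zero => omega
  | succ j ih =>
    rw [popK]
    rcases r with _ | r
    · have e : ({ ρ with uu := [] } : RF) = ρ := by cases ρ; simp only at hρ; subst hρ; rfl
      rw [e] at hs
      exact (Runs.pop_nil _ _ (by simp [hρ]) hs).of_eq rfl (by omega)
    · have h := ih (r := r) (by omega) (ρ := { ρ with uu := List.replicate r true }) rfl (by simpa using hs)
      exact (Runs.pop_true' _ _ (by simp [hρ, List.replicate_succ]) (update_mk_uu ρ _) h).of_eq rfl (by omega)

/-- **The grouping loop**: `u` units on `uu` yield `⌊u / N⌋` budget units pushed onto `w`,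
within `7 u + 1` steps. [folklore] -/
theorem runs_grpLoop (N : ℕ) (hN : 1 ≤ N) : ∀ (u : ℕ) (ρ : RF), ρ.uu = List.replicate u true →
    Runs (.loop .uu (grpBody N) (grpBody N)) (mk ρ)
      (mk { ρ with uu := [], w := bits (List.replicate (u / N) Tok.unit) ++ ρ.w }) (7 * u + 1) := by
  intro u
  induction u using Nat.strong_induction_on with
  | _ u ih =>
    intro ρ hρ
    rcases u with _ | u
    · refine (Runs.loop_nil _ _ (by simp [hρ])).of_eq ?_ (by omega)
      cases ρ; simp only at hρ; subst hρ; simp [Nat.zero_div]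
    · have hR : Function.update (mk ρ) R.uu (List.replicate u true) = mk { ρ with uu := List.replicate u true } := by
        simp
      by_cases hge : N - 1 ≤ u
      · -- a full group
        have hd : Runs (GenProg.pushes .w Tok.unit.code.reverse) (mk { ρ with uu := List.replicate (u - (N - 1)) true })
            (mk { ρ with uu := List.replicate (u - (N - 1)) true, w := Tok.unit.code ++ ρ.w }) 5 :=
          (GenProg.runs_pushes R.w _ _).of_eq (by simp) (by simp [Tok.code])
        have h1 := runs_popK_ge (d := GenProg.pushes .w Tok.unit.code.reverse) (s := .skip) hge
          (ρ := { ρ with uu := List.replicate u true }) rfl hd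
        have h2 := ih (u - (N - 1)) (by omega)
          { ρ with uu := List.replicate (u - (N - 1)) true, w := Tok.unit.code ++ ρ.w } rfl
        refine (Runs.loop_true' (by simp [hρ, List.replicate_succ]) hR h1 h2).of_eq ?_ ?_
        · have e : (u + 1) / N = (u - (N - 1)) / N + 1 := by
            have : u + 1 = (u - (N - 1)) + N := by omega
            rw [this, Nat.add_div_right _ (by omega)]
          simp [e, List.replicate_succ', List.append_assoc]
        · have : (u - (N - 1)) ≤ u := Nat.sub_le _ _
          omega
      · -- a short last group
        have h1 := runs_popK_lt (d := GenProg.pushes .w Tok.unit.code.reverse) (s := .skip) (not_le.1 hge)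
          (ρ := { ρ with uu := List.replicate u true }) rfl ((Runs.skip _).mono (Nat.zero_le 0))
        have h2 : Runs (.loop .uu (grpBody N) (grpBody N)) (mk { ρ with uu := [] }) (mk { ρ with uu := [] }) 1 :=
          Runs.loop_nil _ _ (by simp)
        refine (Runs.loop_true' (by simp [hρ, List.replicate_succ]) hR h1 h2).of_eq ?_ (by omega)
        have e : (u + 1) / N = 0 := Nat.div_eq_of_lt (by omega)
        simp [e]

end Literature.Computability.FineGrained.LightSearch
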